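import Literature.Analysis.FluidPDE.MillerMiddleEigenvalueTorus
import Mathlib.Analysis.Convex.Integral
import Mathlib.Analysis.Convex.SpecificFunctions.Basic
import HarnessLib

/-!
# Chae's spectral dynamics of the strain tensor on `T³`: the two-sided enstrophy law in the
# extreme values of `λ₂^±`, the sign classes `𝒜_±`, and the decay of the eigenvalue ratio — PROVED

Analysis/FluidPDE proof file (theorems only: no definitions, no named facts), sequel of
`MillerMiddleEigenvalueTorus.lean` (same vocabulary: the strain matrix
`S(x) = Matrix.of fun i j => ½((∂ⱼu)ᵢ + (∂ᵢu)ⱼ)` of a field on the flat unit torus `T^d = UnitAddTorus d`,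
`card d = 3`, and its decreasingly SORTED eigenvalues `eigenvalues₀ 0 ≥ eigenvalues₀ 1 ≥ eigenvalues₀ 2`
of Mathlib's `Matrix.IsHermitian`, which are Chae's `λ₁ ≥ λ₂ ≥ λ₃`).
Search for candidate a priori estimates; no regularity claim.

D. Chae, *On the spectral dynamics of the deformation tensor and new a priori estimates for the 3D
Euler equations*, Commun. Math. Phys. 263 (2006) 789–801 = arXiv:math/0503406 — stated there on the
periodic box `T³` for classical solutions `v ∈ C([0,T); H^m_σ)`, `m > 5/2`, of the EULER equations;
the velocity-gradient convention is `V_{ij} = ∂ᵢvⱼ`, `S = ½(V + Vᵀ)`, `tr S = div v = 0`. Typed here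
along the tree's classical solutions `Torus.IsClassicalNSSolutionOn (Icc a b) ν 0 u p` of the unforced
Navier–Stokes / Euler system on a window `[a, b]` (Euler = `ν = 0`), with the tree's normalisation
`ℰ = torusEnstrophy = ½‖∇u‖₂² = ∫∑ᵢⱼSᵢⱼ² = ½∫|ω|²` (`integral_strainNormSq_eq_torusEnstrophy`,
`integral_torusVorticitySqAt_eq_two_mul_torusEnstrophy`):

* §0 (`namespace Chae2005`, real algebra of an ordered zero-sum triple, then the sorted eigenvalues of
  a real symmetric trace-free matrix over a `3`-element index type): Chae's `(basic)`
  `λ₁ ≥ 0 ≥ λ₃`, `|λ₂| ≤ min(λ₁, |λ₃|)` (`eigenvalues_basic`); `(2.8a)`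
  `∑λₖ² = 2(λ₁² + λ₁λ₂ + λ₂²)`; the exact form `−det S = ½λ₂|S|² − λ₂³`
  (`neg_det_eq_half_middle_mul_sum_sq_sub_cube`); the TWO-SIDED pointwise stretching estimate behind Thm 2.2
  **`(½λ₂⁺ − λ₂⁻)·½|S|² ≤ −det S ≤ (λ₂⁺ − ½λ₂⁻)·½|S|²`** (`neg_det_le_and_le`; `λ₂⁺ = max(λ₂,0)`,
  `λ₂⁻ = max(−λ₂,0)`; the upper half without the depletion term `−½λ₂⁻` is Miller's Lemma 5.1, tree
  `Miller2019.neg_det_le_half_normSq_mul_posPart_middleEigenvalue`); and the planar-class bounds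
  `2e²λ₁³ ≤ −det S`, `|S|² ≤ 6λ₁²` under `λ₂ ≥ eλ₁` (`planar_class_pointwise`, proof of Thm 3.2).
* §1 the strain matrix at a point: `isHermitian_strainMatrix` (symmetry; the canonical witness), `tr S = 0`
  (`trace_strainMatrix_eq_zero`), the dictionary `∑ₖλₖ² = |S|²`, `∏ₖλₖ = det S`
  (`sum_eigenvalues_sq_eq_and_prod_eq`) and Chae's (2.8) `∫∑ₖλₖ² = ℰ`, `∫|ω|² = 2∫∑ₖλₖ²`
  (`integral_sum_eigenvalues_sq_eq`).
* §2 **Theorem 2.1** `IsClassicalNSSolutionOn.hasDerivWithinAt_integral_sum_eigenvalues_sq`: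
  `d/dt ∫(λ₁² + λ₂² + λ₃²) = −ν‖Δu‖₂² − 4∫λ₁λ₂λ₃` (one-sided derivative within `[a, b]`; `ν = 0` is
  (2.1) verbatim) — the tree's enstrophy balance `dℰ/dt = −ν‖Δu‖² − 4∫det S`
  (`IsClassicalNSSolutionOn.hasDerivWithinAt_torusEnstrophy_det`) in eigenvalue dress.
* §3 **Theorem 2.2**: rate forms for any `ν`
  (`IsClassicalNSSolutionOn.enstrophyRate_le_of_middleEigenvalue_bounds`:
  `λ₂⁺ ≤ M`, `λ₂⁻ ≥ m` at time `t` ⇒ every one-sided derivative `R` of `ℰ` has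
  `R ≤ −ν‖Δu‖² + (2M − m)ℰ`; `….enstrophyRate_ge_of_middleEigenvalue_bounds`: `λ₂⁺ ≥ m`, `λ₂⁻ ≤ M` ⇒
  `R ≥ −ν‖Δu‖² + (m − 2M)ℰ`), and the integrated two-sided law
  **`(∫|ω(a)|²)·exp∫ₐᵗ(inf λ₂⁺ − 2 sup λ₂⁻) ≤ ∫|ω(t)|² ≤ (∫|ω(a)|²)·exp∫ₐᵗ(2 sup λ₂⁺ − inf λ₂⁻)`**
  (`torusEnstrophy_le_mul_exp_integral_of_middleEigenvalue_bounds` for `ν ≥ 0`,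
  `mul_exp_integral_le_torusEnstrophy_of_middleEigenvalue_bounds` for Euler; sup/inf rendered by
  continuous majorants/minorants on `[a, b]`, as in the Miller file); **Corollary 2.1 / Remark 2.4**
  `integral_vorticitySq_le_mul_exp_two_integral_posMiddleEigenvalueBound`
  (`∫|ω(t)|² ≤ (∫|ω(a)|²) e^{2∫‖λ₂⁺‖_∞}`, `ν ≥ 0`).
* §4 **Theorem 3.1** (the classes `𝒜₊ = {inf λ₂ > 0}` — planar stretching everywhere — and
  `𝒜₋ = {sup λ₂ < 0}` — linear stretching everywhere — up to the first zero-touching time of `λ₂`):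
  `integral_vorticitySq_bounds_of_middleEigenvalue_nonneg` ((i): `0 ≤ m ≤ λ₂ ≤ M` on the window ⇒
  `e^{∫m} ≤ ‖ω(t)‖²/‖ω(a)‖² ≤ e^{2∫M}`) and `integral_vorticitySq_bounds_of_middleEigenvalue_nonpos`
  ((ii): `0 ≤ m ≤ −λ₂ ≤ M` ⇒ `e^{−2∫M} ≤ ‖ω(t)‖²/‖ω(a)‖² ≤ e^{−∫m}`: DECAY).
* §5 **Theorem 3.2 (i)** (ratio decay `inf_{T³×(0,t)} ε < C/√t`, `ε = λ₂/λ₁`): the rate form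
  `IsClassicalNSSolutionOn.enstrophyRate_ge_of_eigenvalueRatio` (`λ₂ ≥ eλ₁` at time `t` ⇒
  `R ≥ −ν‖Δu‖² + 8e²(ℰ/6)^{3/2}`, via `−det S ≥ 2e²λ₁³ ≥ 2e²(|S|²/6)^{3/2}` and Jensen on the
  probability space `T^d` — the uniform-ratio case of Chae's Hölder step (3.6)) and the persistence
  bound **`eigenvalueRatio_persistence_time_lt`: along a classical Euler solution with `λ₂ ≥ eλ₁`
  (`e > 0`) on `[a, b] × T³`, `(t − a)·e²·‖ω(a)‖₂ < √27` and `(t − a)·e²·√ℰ(a) < 3√6/2` for all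
  `t ∈ [a, b]`** — Chae's explicit display `t · inf ε² < √27|Ω|^{1/2}/‖ω₀‖₂` on the unit torus;
  **Theorem 3.2 (ii)** (class `𝒜₋`, `ε = |λ₂|/|λ₃|`): the rate form
  `IsClassicalNSSolutionOn.enstrophyRate_le_of_eigenvalueRatio_bot` (`e(−λ₃) ≤ −λ₂` ⇒
  `R ≤ −ν‖Δu‖² − 8e²(ℰ/6)^{3/2}`) and `eigenvalueRatio_bot_decay_and_persistence`: the DECAY LAW
  `1/√ℰ(a) + (2e²/(3√6))(t − a) ≤ 1/√ℰ(t)` (uniform-ratio form of (3.10)) and, given any floor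
  `0 < ℓ ≤ ℰ` on the window, `(t − a)·e² < 3√6/(2√ℓ)` (Chae's floor `ℓ = H₀²/(4E₀)` comes from
  helicity and energy conservation).
* §6 (v2 append) pointwise comparison of the sorted eigenvalues with `|S|²`
  (`Chae2005.eigenvalues_sq_vs_sum_sq`: `|S|²/6 ≤ λ₁² ≤ ⅔|S|²`, `|S|²/6 ≤ λ₃² ≤ ⅔|S|²`,
  `λ₂² ≤ |S|²/6`, consequences of `(basic)`/(2.8a)) and the EXACT one-snapshot form of Thm 2.1,
  `IsClassicalNSSolutionOn.hasDerivWithinAt_torusEnstrophy_middleEigenvalue`: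
  `dℰ/dt = −ν‖Δu‖₂² + ∫(2λ₂|S|² − 4λ₂³)`.

Faithfulness / scope. (a) Chae's `sup_x`/`inf_x` over `T³` at each time are replaced by continuous
majorant/minorant functions on the window (the same rendering as
`torusEnstrophy_le_mul_exp_integral_middleEigenvalueBound`); for classical solutions the printed
sup/inf are such functions. (b) Thm 2.2's LOWER bound and Thm 3.1/3.2 are typed for Euler (`ν = 0`) as
printed; the UPPER bounds are typed for `ν ≥ 0` (viscosity only helps), which is Remark 2.4's
Navier–Stokes reading. (c) Thm 3.2 is printed as `∃ C = C(v₀, |Ω|)`; we type the proof's explicit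
constant in the uniform-ratio form (hypothesis `λ₂ ≥ eλ₁` on the window in place of the weight
`[∫ε⁻⁴]^{-1/2}` of (3.6)–(3.7)). NOTE [ours]: the proof prints `y² = ½‖ω‖₂²` for
`y² = ∫λ²(ε² + ε + 1) = ½∫|S|²`, whereas (2.8) gives `∫|S|² = ½‖ω‖₂²`, so `y² = ¼‖ω‖₂²` and the
printed final display `t·inf ε² < √27|Ω|^{1/2}/(√2‖ω₀‖₂)` carries a spurious `2^{-1/2}`; the
argument yields `t·inf ε² < √27|Ω|^{1/2}/‖ω₀‖₂`, which is what is proved here (the theorem's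
statement is unaffected). (d) In Thm 3.2 (ii) the final instantiation of the enstrophy floor by
helicity and energy conservation (`H₀ ≤ ‖v‖₂‖ω‖₂ = √(2E₀)‖ω(t)‖₂`, (3.11)–(3.13), which needs `H₀ ≠ 0`)
is NOT typed — the floor `ℓ` is a hypothesis; nor is the `[∫ε⁻⁴]`-weighted form of (3.7)/(3.10).

These serve the functional-mining cell (pub-nsfunc): CRITERIA §A row A10 (strain eigenvalue
criteria) gains the printed TWO-SIDED law with the depletion term `λ₂⁻` and the first LOWER bounds on
enstrophy growth in the ledger (EXTREME-GROWTH: sustained planar stretching with `inf λ₂ ≳ (T−t)⁻¹`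
is what a blow-up needs, Remark 3.1), and the dictionary's strain-eigenvalue family (top/middle
eigenvalue moments, near-biaxial analysis `λ₂ ≈ λ₁`) gains Chae's published persistence bound:
along Euler, uniform biaxiality `λ₂ ≥ eλ₁` cannot last longer than `√27/(e²‖ω(a)‖₂)`.

## Mathlib / tree search

Tree (used): `Chae2005` is cited as the `q = ∞` case in `MillerMiddleEigenvalueTorus` (cite-only) and
in route prose only — no prior typing (`lean`/grep: `Chae2005`, `spectral dynamics`, `λ₂⁻`);
`IsClassicalNSSolutionOn.hasDerivWithinAt_torusEnstrophy_det`, `….hasDerivWithinAt_half_gradNormSq`,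
`det_strain_eq_third_sum_strain_cube`, `integral_strainNormSq_eq_torusEnstrophy`,
`integral_torusVorticitySqAt_eq_two_mul_torusEnstrophy`, `le_mul_exp_integral_of_hasDerivWithinAt_le_mul`
(Grönwall), `GurskyLeBrun.sum_sq_eq_sum_eigenvalues_sq`, `Continuous.integrable_unitAddTorus`.
Mathlib: `Matrix.IsHermitian.eigenvalues₀(_antitone)`, `det_eq_prod_eigenvalues`,
`trace_eq_sum_eigenvalues`, `ConvexOn.map_integral_le` + `convexOn_rpow` (Jensen on the probability
space `T^d`), `antitoneOn_of_hasDerivWithinAt_nonpos`, `HasDerivWithinAt.sqrt/.inv`.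

## References

* [Chae2005] D. Chae, Commun. Math. Phys. 263 (2006) 789–801 = arXiv:math/0503406: Thm 2.1 with proof
  ((2.2)–(2.9)), Thm 2.2 with proof ((basic), (2.8a), the two differential inequalities), Cor 2.1,
  Remarks 2.1–2.4, §3 (classes `𝒜_±`, `T(f)`), Thm 3.1, Thm 3.2 with proof ((3.3)–(3.13)); held text
  paper:arxiv-math_0503406, chunks 4–7 (READ).
* [Miller2019] E. Miller, Arch. Ration. Mech. Anal. 235 (2020) 99–139, Lemma 5.1 / Thm 1.1 (`q = ∞`)
  — the one-sided predecessor in the tree.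
* [MajdaBertozziCUP2002] A. Majda, A. Bertozzi, *Vorticity and Incompressible Flow*, §1.4 (vorticity,
  strain, `|ω|²`).
-/

noncomputable section

open Set MeasureTheory Finset Matrix
open scoped InnerProductSpace RealInnerProductSpace

namespace Literature.Analysis.FluidPDE

open Literature.Analysis.FunctionSpaces

namespace Chae2005

/-! ### §0 Real algebra of an ordered trace-free triple `a ≥ b ≥ c`, `a + b + c = 0`
(the eigenvalues `λ₁ ≥ λ₂ ≥ λ₃` of a trace-free symmetric `3 × 3` matrix) -/

section Algebra

variable {a b c : ℝ}

/-- `λ₁ ≥ 0`: the largest of three reals with zero sum is nonnegative (Chae, proof of Thm 2.2,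
first line). [cite: Chae2005, proof of Thm 2.2 (display (basic))] -/
theorem top_nonneg (hab : b ≤ a) (hbc : c ≤ b) (h : a + b + c = 0) : 0 ≤ a := by linarith

/-- `λ₃ ≤ 0`: the smallest of three reals with zero sum is nonpositive (Chae, proof of Thm 2.2,
first line). [cite: Chae2005, proof of Thm 2.2 (display (basic))] -/
theorem bot_nonpos (hab : b ≤ a) (hbc : c ≤ b) (h : a + b + c = 0) : c ≤ 0 := by linarith

/-- Chae's `(basic)`, first half: `|λ₂| ≤ λ₁`. [cite: Chae2005, proof of Thm 2.2, display (basic)] -/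
theorem abs_middle_le_top (hab : b ≤ a) (hbc : c ≤ b) (h : a + b + c = 0) : |b| ≤ a := by
  rw [abs_le]; constructor <;> linarith

/-- Chae's `(basic)`, second half: `|λ₂| ≤ |λ₃| = -λ₃`.
[cite: Chae2005, proof of Thm 2.2, display (basic)] -/
theorem abs_middle_le_neg_bot (hab : b ≤ a) (hbc : c ≤ b) (h : a + b + c = 0) : |b| ≤ -c := by
  rw [abs_le]; constructor <;> linarith

/-- Chae's `(2.8a)`, first form: `λ₁² + λ₂² + λ₃² = 2(λ₁² + λ₁λ₂ + λ₂²)` when `λ₁ + λ₂ + λ₃ = 0`.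
[cite: Chae2005, proof of Thm 2.2, display (2.8a)] -/
theorem sum_sq_eq_two_mul (h : a + b + c = 0) :
    a ^ 2 + b ^ 2 + c ^ 2 = 2 * (a ^ 2 + a * b + b ^ 2) := by
  have hc : c = -a - b := by linarith
  subst hc; ring

/-- Chae's `(2.8a)`, second form: `λ₁² + λ₂² + λ₃² = 2(λ₁² + λ₁λ₃ + λ₃²)` when `λ₁ + λ₂ + λ₃ = 0`.
[cite: Chae2005, proof of Thm 2.2, display (2.8a)] -/
theorem sum_sq_eq_two_mul' (h : a + b + c = 0) :
    a ^ 2 + b ^ 2 + c ^ 2 = 2 * (a ^ 2 + a * c + c ^ 2) := by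
  have hb : b = -a - c := by linarith
  subst hb; ring

/-- **Exact middle-eigenvalue form of the stretching integrand**: for `a + b + c = 0`,
`−(abc) = ½·b·(a² + b² + c²) − b³` (from (2.8a): `ac = b² − ½(a² + b² + c²)`); both halves of
Chae's two-sided estimate below are one-line consequences, and so is Miller's Lemma 5.1.
[cite: Chae2005, proof of Thm 2.2 ((2.8a))] -/
theorem neg_prod_eq_half_middle_mul_sum_sq_sub_cube (h : a + b + c = 0) :
    -(a * b * c) = 2⁻¹ * b * (a ^ 2 + b ^ 2 + c ^ 2) - b ^ 3 := by
  have hc : c = -a - b := by linarith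
  subst hc; ring

/-- **Upper estimate of the stretching integrand** (Chae, proof of Thm 2.2, display after (2.8a)):
for `a ≥ b ≥ c` with `a + b + c = 0`,
`-(abc) ≤ (b⁺ − ½ b⁻) · ½(a² + b² + c²)`, `b⁺ = max(b, 0)`, `b⁻ = max(−b, 0) = |min(b, 0)|`
(planar stretching `b > 0` amplifies, linear stretching `b < 0` depletes).
[cite: Chae2005, proof of Thm 2.2 (upper estimate of −4∫λ₁λ₂λ₃)] -/
theorem neg_prod_le (hbc : c ≤ b) (h : a + b + c = 0) :
    -(a * b * c) ≤ (max b 0 - 2⁻¹ * max (-b) 0) * (2⁻¹ * (a ^ 2 + b ^ 2 + c ^ 2)) := by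
  have hc : c = -a - b := by linarith
  subst hc
  rcases le_or_gt 0 b with hb | hb
  · rw [max_eq_left hb, max_eq_right (by linarith : -b ≤ 0)]
    have key : (b - 2⁻¹ * 0) * (2⁻¹ * (a ^ 2 + b ^ 2 + (-a - b) ^ 2)) - -(a * b * (-a - b)) =
        b ^ 3 := by ring
    have h3 : 0 ≤ b ^ 3 := pow_nonneg hb 3
    linarith
  · rw [max_eq_right hb.le, max_eq_left (by linarith : 0 ≤ -b)]
    have h1 : 0 ≤ a + 2 * b := by linarith
    have h2 : 0 ≤ a - b := by linarith
    have key : (0 - 2⁻¹ * -b) * (2⁻¹ * (a ^ 2 + b ^ 2 + (-a - b) ^ 2)) - -(a * b * (-a - b)) =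
        (-b / 2) * ((a + 2 * b) * (a - b) + b ^ 2) := by ring
    have h4 : 0 ≤ (-b / 2) * ((a + 2 * b) * (a - b) + b ^ 2) :=
      mul_nonneg (by linarith) (add_nonneg (mul_nonneg h1 h2) (sq_nonneg b))
    linarith

/-- **Lower estimate of the stretching integrand** (Chae, proof of Thm 2.2, display (right) ff.):
for `a ≥ b ≥ c` with `a + b + c = 0`, `(½ b⁺ − b⁻) · ½(a² + b² + c²) ≤ -(abc)`.
[cite: Chae2005, proof of Thm 2.2 (lower estimate of −4∫λ₁λ₂λ₃)] -/
theorem le_neg_prod (hab : b ≤ a) (hbc : c ≤ b) (h : a + b + c = 0) :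
    (2⁻¹ * max b 0 - max (-b) 0) * (2⁻¹ * (a ^ 2 + b ^ 2 + c ^ 2)) ≤ -(a * b * c) := by
  have hc : c = -a - b := by linarith
  subst hc
  rcases le_or_gt 0 b with hb | hb
  · rw [max_eq_left hb, max_eq_right (by linarith : -b ≤ 0)]
    have h1 : 0 ≤ a - b := by linarith
    have h2 : 0 ≤ a + b := by linarith
    have key : -(a * b * (-a - b)) - (2⁻¹ * b - 0) * (2⁻¹ * (a ^ 2 + b ^ 2 + (-a - b) ^ 2)) =
        (b / 2) * ((a - b) * (a + b) + a * b) := by ring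
    have h4 : 0 ≤ (b / 2) * ((a - b) * (a + b) + a * b) :=
      mul_nonneg (by linarith) (add_nonneg (mul_nonneg h1 h2) (mul_nonneg (by linarith) hb))
    linarith
  · rw [max_eq_right hb.le, max_eq_left (by linarith : 0 ≤ -b)]
    have key : -(a * b * (-a - b)) - (2⁻¹ * 0 - -b) * (2⁻¹ * (a ^ 2 + b ^ 2 + (-a - b) ^ 2)) =
        -b ^ 3 := by ring
    have h3 : 0 ≤ -b ^ 3 := by
      have : b ^ 3 ≤ 0 := by
        have := pow_nonneg (neg_nonneg.2 hb.le) 3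
        nlinarith
      linarith
    linarith

/-- **Uniform planar stretching** (Chae, proof of Thm 3.2 (i), displays (3.4)–(3.5) combined): for
`a ≥ b ≥ c` with `a + b + c = 0` and `b ≥ e·a` (eigenvalue ratio `ε = λ₂/λ₁ ≥ e`; the paper
writes `λ₂ = ελ₁`, `λ₃ = −(1 + ε)λ₁`, `−λ₁λ₂λ₃ = λ₁³(ε² + ε) ≥ 2ε²λ₁³` and
`λ₁² + λ₂² + λ₃² = 2λ₁²(ε² + ε + 1) ≤ 6λ₁²`): `-(abc) ≥ 2e² a³` and `a² + b² + c² ≤ 6a²`.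
[cite: Chae2005, proof of Thm 3.2 (i), (3.4)–(3.5)] -/
theorem two_mul_sq_mul_cube_le_neg_prod (hab : b ≤ a) (hbc : c ≤ b) (h : a + b + c = 0)
    {e : ℝ} (he : 0 ≤ e) (hb : e * a ≤ b) :
    2 * e ^ 2 * a ^ 3 ≤ -(a * b * c) := by
  have ha : 0 ≤ a := top_nonneg hab hbc h
  have hc : c = -a - b := by linarith
  subst hc
  have hb0 : 0 ≤ b := le_trans (mul_nonneg he ha) hb
  -- `-(ab(-a-b)) = ab(a+b) ≥ (ea)·a·(a + ea)`? we use `b ≥ ea` twice and `a + b ≥ a + ea ≥ 2ea`? no: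
  -- `ab(a+b) ≥ a·(ea)·(a+b) ≥ a·(ea)·(a + ea)`, and `a + ea ≥ 2ea` iff `a ≥ ea`, true as `e ≤ 1`
  -- is NOT assumed; instead use `b ≤ a`: `a + b ≥ 2b ≥ 2ea`.
  have h1 : e * a * (2 * (e * a)) ≤ b * (a + b) := by
    have : 2 * (e * a) ≤ a + b := by linarith
    exact mul_le_mul hb this (by positivity) hb0
  have h2 : -(a * b * (-a - b)) = a * (b * (a + b)) := by ring
  rw [h2]
  have h3 : 2 * e ^ 2 * a ^ 3 = a * (e * a * (2 * (e * a))) := by ring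
  rw [h3]
  exact mul_le_mul_of_nonneg_left h1 ha

/-- Second half of the previous docstring: `a² + b² + c² ≤ 6a²` for `a ≥ b ≥ c`, `a + b + c = 0`,
`b ≥ 0` (so `|M|² ≤ 6λ₁²`, i.e. `λ₁ ≥ |M|/√6`, on the planar-stretching class).
[cite: Chae2005, proof of Thm 3.2 (i), (3.4)] -/
theorem sum_sq_le_six_mul_sq (hab : b ≤ a) (h : a + b + c = 0) (hb : 0 ≤ b) :
    a ^ 2 + b ^ 2 + c ^ 2 ≤ 6 * a ^ 2 := by
  have hc : c = -a - b := by linarith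
  subst hc
  nlinarith [mul_nonneg hb (by linarith : 0 ≤ a - b), mul_nonneg hb (by linarith : (0:ℝ) ≤ a + b)]

/-- Mirror image of `two_mul_sq_mul_cube_le_neg_prod` for the LINEAR-stretching class (Chae, proof of
Thm 3.2 (ii): `λ₁ = (1+ε)λ`, `λ₂ = −ελ`, `λ₃ = −λ`, `λ = −λ₃ > 0`, `ε = |λ₂|/|λ₃| ≥ e`): for `a ≥ b ≥ c`
with `a + b + c = 0` and `−b ≥ e·(−c)`, `−(abc) ≤ −2e²(−c)³` (apply the planar case to `(−c, −b, −a)`).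
[cite: Chae2005, proof of Thm 3.2 (ii), (3.8)–(3.9)] -/
theorem neg_prod_le_neg_two_mul_sq_mul_cube (hab : b ≤ a) (hbc : c ≤ b) (h : a + b + c = 0)
    {e : ℝ} (he : 0 ≤ e) (hb : e * -c ≤ -b) :
    -(a * b * c) ≤ -(2 * e ^ 2 * (-c) ^ 3) := by
  have := two_mul_sq_mul_cube_le_neg_prod (a := -c) (b := -b) (c := -a) (by linarith) (by linarith)
    (by linarith) he hb
  linarith

/-- `a² + b² + c² ≤ 6c²` for `a ≥ b ≥ c`, `a + b + c = 0`, `b ≤ 0` (`|M|² ≤ 6λ₃²` on the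
linear-stretching class). [cite: Chae2005, proof of Thm 3.2 (ii)] -/
theorem sum_sq_le_six_mul_sq_bot (hbc : c ≤ b) (h : a + b + c = 0) (hb : b ≤ 0) :
    a ^ 2 + b ^ 2 + c ^ 2 ≤ 6 * c ^ 2 := by
  have := sum_sq_le_six_mul_sq (a := -c) (b := -b) (c := -a) (by linarith) (by linarith) (by linarith)
  linarith

end Algebra

/-! ### §0′ The same statements for the sorted eigenvalues of a real symmetric trace-free matrix
over an index type of cardinality `3` (Mathlib's `eigenvalues₀` is antitone:
`eigenvalues₀ 0 ≥ eigenvalues₀ 1 ≥ eigenvalues₀ 2`) -/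

section Matrix3

variable {n : Type*} [Fintype n] [DecidableEq n]

/-- Bookkeeping for a real symmetric trace-free matrix over a `3`-element index type: with
`λ_k = eigenvalues₀ k` (sorted decreasingly), `λ₁ ≥ λ₂ ≥ λ₃`, `λ₁ + λ₂ + λ₃ = tr M = 0`,
`det M = λ₁λ₂λ₃`, `∑ᵢⱼ Mᵢⱼ² = λ₁² + λ₂² + λ₃²` (spectral theorem; Chae (2.8)–(2.9)).
[cite: Chae2005, §2, (2.8)–(2.9)] -/
theorem eigenvalues_bookkeeping (hn : Fintype.card n = 3) (M : Matrix n n ℝ) (hH : M.IsHermitian)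
    (htr : M.trace = 0) :
    hH.eigenvalues₀ (Fin.cast hn.symm 1) ≤ hH.eigenvalues₀ (Fin.cast hn.symm 0) ∧
    hH.eigenvalues₀ (Fin.cast hn.symm 2) ≤ hH.eigenvalues₀ (Fin.cast hn.symm 1) ∧
    hH.eigenvalues₀ (Fin.cast hn.symm 0) + hH.eigenvalues₀ (Fin.cast hn.symm 1) +
      hH.eigenvalues₀ (Fin.cast hn.symm 2) = 0 ∧
    M.det = hH.eigenvalues₀ (Fin.cast hn.symm 0) * hH.eigenvalues₀ (Fin.cast hn.symm 1) *
      hH.eigenvalues₀ (Fin.cast hn.symm 2) ∧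
    ∑ i, ∑ j, M i j ^ 2 = hH.eigenvalues₀ (Fin.cast hn.symm 0) ^ 2 +
      hH.eigenvalues₀ (Fin.cast hn.symm 1) ^ 2 + hH.eigenvalues₀ (Fin.cast hn.symm 2) ^ 2 := by
  have hsym : M.IsSymm := Matrix.isHermitian_iff_isSymm.mp hH
  set lam : Fin 3 → ℝ := fun a => hH.eigenvalues₀ (Fin.cast hn.symm a) with hlam
  have hE : ∀ f : ℝ → ℝ, ∑ i, f (hH.eigenvalues i) = ∑ a : Fin 3, f (lam a) := by
    intro f
    have h1 : ∑ i, f (hH.eigenvalues i) = ∑ k, f (hH.eigenvalues₀ k) :=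
      Fintype.sum_equiv (Fintype.equivOfCardEq (Fintype.card_fin _)).symm _ _ (fun i => rfl)
    rw [h1]
    exact Fintype.sum_equiv (finCongr hn) _ _ (fun k => by simp [hlam, finCongr])
  have hP : ∏ i, hH.eigenvalues i = ∏ a : Fin 3, lam a := by
    have h1 : ∏ i, hH.eigenvalues i = ∏ k, hH.eigenvalues₀ k :=
      Fintype.prod_equiv (Fintype.equivOfCardEq (Fintype.card_fin _)).symm _ _ (fun i => rfl)
    rw [h1]
    exact Fintype.prod_equiv (finCongr hn) _ _ (fun k => by simp [hlam, finCongr])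
  have hdet : M.det = ∏ a : Fin 3, lam a := by
    have := hH.det_eq_prod_eigenvalues
    simp only [RCLike.ofReal_real_eq_id, id_eq] at this
    rw [this, hP]
  have htr' : ∑ a : Fin 3, lam a = 0 := by
    have := hH.trace_eq_sum_eigenvalues
    simp only [RCLike.ofReal_real_eq_id, id_eq] at this
    rw [← hE (fun x => x), ← this, htr]
  have hfro : ∑ i, ∑ j, M i j ^ 2 = ∑ a : Fin 3, lam a ^ 2 := by
    rw [Literature.Geometry.Riemannian.GurskyLeBrun.sum_sq_eq_sum_eigenvalues_sq hsym]
    exact hE (fun x => x ^ 2)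
  have hanti : Antitone lam := fun a b hab =>
    hH.eigenvalues₀_antitone ((Fin.cast_le_cast hn.symm).mpr hab)
  simp only [Fin.sum_univ_three, Fin.prod_univ_three] at htr' hdet hfro
  exact ⟨hanti (by decide), hanti (by decide), htr', hdet, hfro⟩

/-- **`λ₁ ≥ 0`, `λ₃ ≤ 0`, `|λ₂| ≤ min(λ₁, |λ₃|)`** for the sorted eigenvalues of a real symmetric
trace-free matrix over a `3`-element index type (Chae's `(basic)`).
[cite: Chae2005, proof of Thm 2.2, display (basic)] -/
theorem eigenvalues_basic (hn : Fintype.card n = 3) (M : Matrix n n ℝ) (hH : M.IsHermitian)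
    (htr : M.trace = 0) :
    0 ≤ hH.eigenvalues₀ (Fin.cast hn.symm 0) ∧ hH.eigenvalues₀ (Fin.cast hn.symm 2) ≤ 0 ∧
    |hH.eigenvalues₀ (Fin.cast hn.symm 1)| ≤ hH.eigenvalues₀ (Fin.cast hn.symm 0) ∧
    |hH.eigenvalues₀ (Fin.cast hn.symm 1)| ≤ -hH.eigenvalues₀ (Fin.cast hn.symm 2) := by
  obtain ⟨h10, h21, hsum, -, -⟩ := eigenvalues_bookkeeping hn M hH htr
  exact ⟨top_nonneg h10 h21 hsum, bot_nonpos h10 h21 hsum, abs_middle_le_top h10 h21 hsum,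
    abs_middle_le_neg_bot h10 h21 hsum⟩

/-- **`−det M = ½λ₂|M|² − λ₂³` exactly**, for a real symmetric trace-free matrix over a `3`-element
index type (`λ₂ = eigenvalues₀ 1` the middle eigenvalue, `|M|² = ∑ᵢⱼ Mᵢⱼ²`): the exact form behind
Chae's two-sided estimate and Miller's Lemma 5.1. [cite: Chae2005, proof of Thm 2.2 ((2.8a)–(2.9))] -/
theorem neg_det_eq_half_middle_mul_sum_sq_sub_cube (hn : Fintype.card n = 3) (M : Matrix n n ℝ)
    (hH : M.IsHermitian) (htr : M.trace = 0) :
    -M.det = 2⁻¹ * hH.eigenvalues₀ (Fin.cast hn.symm 1) * (∑ i, ∑ j, M i j ^ 2) -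
      hH.eigenvalues₀ (Fin.cast hn.symm 1) ^ 3 := by
  obtain ⟨-, -, hsum, hdet, hfro⟩ := eigenvalues_bookkeeping hn M hH htr
  rw [hdet, hfro]
  exact neg_prod_eq_half_middle_mul_sum_sq_sub_cube hsum

/-- **Chae's two-sided pointwise bound on `−det` by the middle eigenvalue** (proof of Thm 2.2): for a
real symmetric trace-free matrix `M` over a `3`-element index type, with `λ₂ = eigenvalues₀ 1`,
`λ₂⁺ = max(λ₂, 0)`, `λ₂⁻ = max(−λ₂, 0)` and `|M|² = ∑ᵢⱼ Mᵢⱼ²`,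
`(½λ₂⁺ − λ₂⁻) · ½|M|² ≤ −det M ≤ (λ₂⁺ − ½λ₂⁻) · ½|M|²`
(the upper half with `λ₂⁻` dropped is Miller's Lemma 5.1, tree
`Miller2019.neg_det_le_half_normSq_mul_posPart_middleEigenvalue`).
[cite: Chae2005, proof of Thm 2.2 (two-sided estimate of −4∫λ₁λ₂λ₃)] -/
theorem neg_det_le_and_le (hn : Fintype.card n = 3) (M : Matrix n n ℝ) (hH : M.IsHermitian)
    (htr : M.trace = 0) :
    (2⁻¹ * max (hH.eigenvalues₀ (Fin.cast hn.symm 1)) 0 -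
        max (-hH.eigenvalues₀ (Fin.cast hn.symm 1)) 0) * (2⁻¹ * ∑ i, ∑ j, M i j ^ 2) ≤ -M.det ∧
    -M.det ≤ (max (hH.eigenvalues₀ (Fin.cast hn.symm 1)) 0 -
        2⁻¹ * max (-hH.eigenvalues₀ (Fin.cast hn.symm 1)) 0) * (2⁻¹ * ∑ i, ∑ j, M i j ^ 2) := by
  obtain ⟨h10, h21, hsum, hdet, hfro⟩ := eigenvalues_bookkeeping hn M hH htr
  rw [hdet, hfro]
  exact ⟨le_neg_prod h10 h21 hsum, neg_prod_le h21 hsum⟩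

/-- **Planar-stretching class, pointwise** (Chae, proof of Thm 3.2 (i)): for a real symmetric
trace-free matrix over a `3`-element index type whose eigenvalue ratio satisfies `λ₂ ≥ e·λ₁` with
`e ≥ 0`: `2e²λ₁³ ≤ −det M` and `|M|² ≤ 6λ₁²`. [cite: Chae2005, proof of Thm 3.2 (i), (3.4)–(3.5)] -/
theorem planar_class_pointwise (hn : Fintype.card n = 3) (M : Matrix n n ℝ) (hH : M.IsHermitian)
    (htr : M.trace = 0) {e : ℝ} (he : 0 ≤ e)
    (hratio : e * hH.eigenvalues₀ (Fin.cast hn.symm 0) ≤ hH.eigenvalues₀ (Fin.cast hn.symm 1)) :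
    2 * e ^ 2 * hH.eigenvalues₀ (Fin.cast hn.symm 0) ^ 3 ≤ -M.det ∧
    ∑ i, ∑ j, M i j ^ 2 ≤ 6 * hH.eigenvalues₀ (Fin.cast hn.symm 0) ^ 2 := by
  obtain ⟨h10, h21, hsum, hdet, hfro⟩ := eigenvalues_bookkeeping hn M hH htr
  have hb : 0 ≤ hH.eigenvalues₀ (Fin.cast hn.symm 1) :=
    le_trans (mul_nonneg he (top_nonneg h10 h21 hsum)) hratio
  rw [hdet, hfro]
  exact ⟨two_mul_sq_mul_cube_le_neg_prod h10 h21 hsum he hratio, sum_sq_le_six_mul_sq h10 hsum hb⟩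

/-- **Linear-stretching class, pointwise** (Chae, proof of Thm 3.2 (ii)): for a real symmetric
trace-free matrix over a `3`-element index type with `|λ₂| ≥ e|λ₃|` in the form `e·(−λ₃) ≤ −λ₂`
(`e ≥ 0`; this forces `λ₂ ≤ 0`): `−det M ≤ −2e²(−λ₃)³` and `|M|² ≤ 6λ₃²`.
[cite: Chae2005, proof of Thm 3.2 (ii), (3.8)–(3.9)] -/
theorem linear_class_pointwise (hn : Fintype.card n = 3) (M : Matrix n n ℝ) (hH : M.IsHermitian)
    (htr : M.trace = 0) {e : ℝ} (he : 0 ≤ e)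
    (hratio : e * -hH.eigenvalues₀ (Fin.cast hn.symm 2) ≤ -hH.eigenvalues₀ (Fin.cast hn.symm 1)) :
    -M.det ≤ -(2 * e ^ 2 * (-hH.eigenvalues₀ (Fin.cast hn.symm 2)) ^ 3) ∧
    ∑ i, ∑ j, M i j ^ 2 ≤ 6 * hH.eigenvalues₀ (Fin.cast hn.symm 2) ^ 2 := by
  obtain ⟨h10, h21, hsum, hdet, hfro⟩ := eigenvalues_bookkeeping hn M hH htr
  have hb : hH.eigenvalues₀ (Fin.cast hn.symm 1) ≤ 0 := by
    have h3 : 0 ≤ -hH.eigenvalues₀ (Fin.cast hn.symm 2) := by linarith [bot_nonpos h10 h21 hsum]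
    nlinarith [mul_nonneg he h3]
  rw [hdet, hfro]
  exact ⟨neg_prod_le_neg_two_mul_sq_mul_cube h10 h21 hsum he hratio, sum_sq_le_six_mul_sq_bot h21 hsum hb⟩

end Matrix3

end Chae2005

/-! ### §1 The strain matrix of a field on `T^d` at a point, `card d = 3`: symmetry, trace,
eigenvalue dictionary `∑ₖ λₖ² = |S|²`, `∏ₖ λₖ = det S`, and Chae's (2.8) `∫(λ₁²+λ₂²+λ₃²) = ½‖ω‖²` -/

variable {d : Type*} [Fintype d] [DecidableEq d]

/-- The strain (deformation) matrix `S(x) = Matrix.of fun i j => ½((∂ⱼv)ᵢ + (∂ᵢv)ⱼ)` of a field on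
`T^d` is Hermitian (real symmetric: Chae, §2, `S_{ij} = ½(V_{ij} + V_{ji})`); this canonical witness is
the one whose sorted eigenvalues `eigenvalues₀ 0 ≥ eigenvalues₀ 1 ≥ eigenvalues₀ 2` are Chae's
`λ₁ ≥ λ₂ ≥ λ₃` below (any other witness gives the same eigenvalues, by proof irrelevance); Chae, §2:
"let `λ₁, λ₂, λ₃` be the eigenvalues of the deformation tensor `S`". [cite: Chae2005, §2 (Thm 2.1, eigenvalues of S)] -/
theorem isHermitian_strainMatrix (v : UnitAddTorus d → EuclideanSpace ℝ d) (x : UnitAddTorus d) :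
    (Matrix.of fun i j => (Torus.partialDeriv j v x i + Torus.partialDeriv i v x j) / 2).IsHermitian :=
  Matrix.isHermitian_iff_isSymm.mpr (Matrix.IsSymm.ext fun i j => by simp only [Matrix.of_apply]; ring)

/-- `tr S(x) = div v(x) = 0` for a `C¹` divergence-free field (Chae, §2: "for incompressible fluid we
have `Tr(S) = div v = 0`"). [cite: Chae2005, §2 (Tr S = div v = 0)] -/
theorem trace_strainMatrix_eq_zero {v : UnitAddTorus d → EuclideanSpace ℝ d} (hv : Torus.IsSmooth v)
    (hdiv : Torus.IsDivFree v) (x : UnitAddTorus d) :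
    (Matrix.of fun i j => (Torus.partialDeriv j v x i + Torus.partialDeriv i v x j) / 2).trace = 0 := by
  simp only [Matrix.trace, Matrix.diag, Matrix.of_apply]
  have h1 : ∑ i, (Torus.partialDeriv i v x i + Torus.partialDeriv i v x i) / 2 =
      ∑ i, Torus.partialDeriv i v x i := Finset.sum_congr rfl fun i _ => by ring
  rw [h1, ← Torus.divergence_eq_sum_partialDeriv_apply (hv.isContDiff (by simp)) x]
  exact hdiv x

/-- **Eigenvalue dictionary, pointwise** (Chae (2.8)–(2.9)): for a smooth divergence-free field on
`T^d`, `card d = 3`, at every point `∑ₖ λₖ(x)² = ∑ᵢⱼ Sᵢⱼ(x)²` and `∏ₖ λₖ(x) = det S(x)`, the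
`λₖ` being the sorted eigenvalues of the strain matrix. [cite: Chae2005, §2, (2.8)–(2.9)] -/
theorem sum_eigenvalues_sq_eq_and_prod_eq (hd : Fintype.card d = 3)
    {v : UnitAddTorus d → EuclideanSpace ℝ d} (hv : Torus.IsSmooth v) (hdiv : Torus.IsDivFree v)
    (x : UnitAddTorus d) :
    (∑ k : Fin 3, (isHermitian_strainMatrix v x).eigenvalues₀ (Fin.cast hd.symm k) ^ 2 =
      ∑ i, ∑ j, ((Torus.partialDeriv j v x i + Torus.partialDeriv i v x j) / 2) ^ 2) ∧
    (∏ k : Fin 3, (isHermitian_strainMatrix v x).eigenvalues₀ (Fin.cast hd.symm k) =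
      Matrix.det (Matrix.of fun i j => (Torus.partialDeriv j v x i + Torus.partialDeriv i v x j) / 2)) := by
  obtain ⟨-, -, -, hdet, hfro⟩ := Chae2005.eigenvalues_bookkeeping hd _ (isHermitian_strainMatrix v x)
    (trace_strainMatrix_eq_zero hv hdiv x)
  simp only [Fin.sum_univ_three, Fin.prod_univ_three]
  refine ⟨?_, hdet.symm⟩
  rw [← hfro]
  simp only [Matrix.of_apply]

/-- **Chae's (2.8): `∫|ω|² = 2∫∑ᵢⱼSᵢⱼ² = 2∫(λ₁² + λ₂² + λ₃²)`**, torus form with the tree's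
normalisation `∫∑ᵢⱼSᵢⱼ² = ℰ(v) = ½‖∇v‖₂²`: for a smooth divergence-free field on `T^d`, `card d = 3`,
`∫ ∑ₖ λₖ(x)² dx = torusEnstrophy v` and `∫ torusVorticitySqAt v = 2 ∫ ∑ₖ λₖ²`.
[cite: Chae2005, §2, (2.8)] -/
theorem integral_sum_eigenvalues_sq_eq (hd : Fintype.card d = 3)
    {v : UnitAddTorus d → EuclideanSpace ℝ d} (hv : Torus.IsSmooth v) (hdiv : Torus.IsDivFree v) :
    (∫ x, ∑ k : Fin 3, (isHermitian_strainMatrix v x).eigenvalues₀ (Fin.cast hd.symm k) ^ 2) =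
      torusEnstrophy v ∧
    (∫ x, torusVorticitySqAt v x) =
      2 * ∫ x, ∑ k : Fin 3, (isHermitian_strainMatrix v x).eigenvalues₀ (Fin.cast hd.symm k) ^ 2 := by
  have h1 : (∫ x, ∑ k : Fin 3, (isHermitian_strainMatrix v x).eigenvalues₀ (Fin.cast hd.symm k) ^ 2) =
      torusEnstrophy v := by
    rw [← integral_strainNormSq_eq_torusEnstrophy hv hdiv]
    exact integral_congr_ae (Filter.Eventually.of_forall fun x =>
      (sum_eigenvalues_sq_eq_and_prod_eq hd hv hdiv x).1)
  exact ⟨h1, by rw [h1, integral_torusVorticitySqAt_eq_two_mul_torusEnstrophy hv hdiv]⟩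

/-! ### §2 Theorem 2.1 — the spectral dynamics identity along classical Euler / Navier–Stokes flows -/

/-- **Chae's Theorem 2.1 (spectral dynamics of the deformation tensor), periodic classical form.**
Along a classical solution of the unforced Navier–Stokes equations with viscosity `ν` on
`T^d × [a, b]` (`card d = 3`, `a < b`; Euler is `ν = 0`, the printed case), the eigenvalues
`λ₁ ≥ λ₂ ≥ λ₃` of the strain `S = ½(∇u + ∇uᵀ)` satisfy, at every `t ∈ [a, b]`,
`d/dt ∫(λ₁² + λ₂² + λ₃²) dx = −ν‖Δu‖₂² − 4∫ λ₁λ₂λ₃ dx`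
(one-sided derivative within `[a, b]`; for `ν = 0` this is (2.1) verbatim). Proof as printed: the
enstrophy balance `dℰ/dt = −ν‖Δu‖² − 4∫det S` (tree
`IsClassicalNSSolutionOn.hasDerivWithinAt_torusEnstrophy_det`, Chae's (2.2)–(2.6)) dressed with
`∑λₖ² = |S|²`, `∏λₖ = det S`. [cite: Chae2005, Thm 2.1] -/
theorem _root_.Literature.Analysis.FunctionSpaces.Torus.IsClassicalNSSolutionOn.hasDerivWithinAt_integral_sum_eigenvalues_sq
    (hd : Fintype.card d = 3) {a b ν : ℝ} {u : ℝ → UnitAddTorus d → EuclideanSpace ℝ d}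
    {p : ℝ → UnitAddTorus d → ℝ} (h : Torus.IsClassicalNSSolutionOn (Icc a b) ν 0 u p)
    (hab : a < b) {t : ℝ} (ht : t ∈ Icc a b) :
    HasDerivWithinAt
      (fun s => ∫ x, ∑ k : Fin 3, (isHermitian_strainMatrix (u s) x).eigenvalues₀ (Fin.cast hd.symm k) ^ 2)
      (-ν * (∫ x, ‖Torus.laplacian (u t) x‖ ^ 2) -
        4 * ∫ x, ∏ k : Fin 3, (isHermitian_strainMatrix (u t) x).eigenvalues₀ (Fin.cast hd.symm k))
      (Icc a b) t := by
  have hbal := h.hasDerivWithinAt_torusEnstrophy_det hd hab ht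
  have hfun : ∀ s ∈ Icc a b,
      (∫ x, ∑ k : Fin 3, (isHermitian_strainMatrix (u s) x).eigenvalues₀ (Fin.cast hd.symm k) ^ 2) =
        torusEnstrophy (u s) := fun s hs =>
    (integral_sum_eigenvalues_sq_eq hd (h.smooth_velocity.isSmooth_slice hs) (h.divFree s hs)).1
  have hdet : (∫ x, ∏ k : Fin 3, (isHermitian_strainMatrix (u t) x).eigenvalues₀ (Fin.cast hd.symm k)) =
      ∫ x, Matrix.det (Matrix.of fun i j =>
        (Torus.partialDeriv j (u t) x i + Torus.partialDeriv i (u t) x j) / 2) :=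
    integral_congr_ae (Filter.Eventually.of_forall fun x =>
      (sum_eigenvalues_sq_eq_and_prod_eq hd (h.smooth_velocity.isSmooth_slice ht) (h.divFree t ht) x).2)
  rw [hdet]
  exact hbal.congr hfun (hfun t ht)

/-! ### §3 Theorem 2.2 — the two-sided enstrophy law in `sup λ₂⁺`, `inf λ₂⁻` (rate forms for any `ν`,
integrated forms: upper for `ν ≥ 0`, lower for Euler), and Corollary 2.1 -/

/-- **Theorem 2.2, upper rate form** (Chae, proof of Thm 2.2: `d/dt‖ω‖² ≤ [2 sup λ₂⁺ − inf|λ₂⁻|]‖ω‖²`,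
here for `ℰ = ½‖ω‖₂²` and keeping the viscous term): along a classical solution of the unforced
Navier–Stokes equations on `T^d × [a, b]` (`card d = 3`, `a < b`, any `ν`), if at time `t ∈ [a, b]`
`λ₂⁺(t, x) ≤ M` and `m ≤ λ₂⁻(t, x)` for every `x` (`λ₂ = eigenvalues₀ 1` the middle eigenvalue of the
strain `S(t, x)`, for every Hermitian-ness witness `hx`; `λ₂⁺ = max(λ₂, 0)`, `λ₂⁻ = max(−λ₂, 0)`),
then every one-sided derivative `R` of `s ↦ ℰ(u s)` within `[a, b]` at `t` satisfies
`R ≤ −ν‖Δu(t)‖₂² + (2M − m)·ℰ(u t)`. [cite: Chae2005, Thm 2.2 (proof, upper differential inequality)] -/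
theorem _root_.Literature.Analysis.FunctionSpaces.Torus.IsClassicalNSSolutionOn.enstrophyRate_le_of_middleEigenvalue_bounds
    (hd : Fintype.card d = 3) {a b ν : ℝ} {u : ℝ → UnitAddTorus d → EuclideanSpace ℝ d}
    {p : ℝ → UnitAddTorus d → ℝ} (h : Torus.IsClassicalNSSolutionOn (Icc a b) ν 0 u p)
    (hab : a < b) {t : ℝ} (ht : t ∈ Icc a b) {M m : ℝ}
    (hM : ∀ x, ∀ hx : (Matrix.of fun i j =>
        (Torus.partialDeriv j (u t) x i + Torus.partialDeriv i (u t) x j) / 2).IsHermitian,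
        max (hx.eigenvalues₀ (Fin.cast hd.symm 1)) 0 ≤ M)
    (hm : ∀ x, ∀ hx : (Matrix.of fun i j =>
        (Torus.partialDeriv j (u t) x i + Torus.partialDeriv i (u t) x j) / 2).IsHermitian,
        m ≤ max (-hx.eigenvalues₀ (Fin.cast hd.symm 1)) 0)
    (R : ℝ) (hR : HasDerivWithinAt (fun s => torusEnstrophy (u s)) R (Icc a b) t) :
    R ≤ -ν * (∫ x, ‖Torus.laplacian (u t) x‖ ^ 2) + (2 * M - m) * torusEnstrophy (u t) := by
  have hut : Torus.IsSmooth (u t) := h.smooth_velocity.isSmooth_slice ht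
  have hdivt : Torus.IsDivFree (u t) := h.divFree t ht
  have hU : UniqueDiffWithinAt ℝ (Icc a b) t := uniqueDiffOn_Icc hab t ht
  have hbal := h.hasDerivWithinAt_torusEnstrophy_det hd hab ht
  have hReq : R = -ν * (∫ x, ‖Torus.laplacian (u t) x‖ ^ 2) -
      4 * ∫ x, Matrix.det (Matrix.of fun i j =>
        (Torus.partialDeriv j (u t) x i + Torus.partialDeriv i (u t) x j) / 2) :=
    (hR.derivWithin hU).symm.trans (hbal.derivWithin hU)
  set Sd : UnitAddTorus d → Matrix d d ℝ := fun x => Matrix.of fun i j =>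
    (Torus.partialDeriv j (u t) x i + Torus.partialDeriv i (u t) x j) / 2 with hSd
  set F : UnitAddTorus d → ℝ := fun x => ∑ i, ∑ j,
    ((Torus.partialDeriv j (u t) x i + Torus.partialDeriv i (u t) x j) / 2) ^ 2 with hF
  have hF0 : ∀ x, 0 ≤ F x := fun x =>
    Finset.sum_nonneg fun i _ => Finset.sum_nonneg fun j _ => sq_nonneg _
  have hpt : ∀ x, -4 * (Sd x).det ≤ (2 * M - m) * F x := by
    intro x
    have hH : (Sd x).IsHermitian := isHermitian_strainMatrix (u t) x
    have htr : (Sd x).trace = 0 := trace_strainMatrix_eq_zero hut hdivt x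
    have h2 := (Chae2005.neg_det_le_and_le hd (Sd x) hH htr).2
    have hFx : ∑ i, ∑ j, Sd x i j ^ 2 = F x := by simp only [hSd, hF, Matrix.of_apply]
    rw [hFx] at h2
    have hcoef : max (hH.eigenvalues₀ (Fin.cast hd.symm 1)) 0 -
        2⁻¹ * max (-hH.eigenvalues₀ (Fin.cast hd.symm 1)) 0 ≤ M - 2⁻¹ * m := by
      have := hM x hH; have := hm x hH; linarith
    have h3 : (max (hH.eigenvalues₀ (Fin.cast hd.symm 1)) 0 -
        2⁻¹ * max (-hH.eigenvalues₀ (Fin.cast hd.symm 1)) 0) * (2⁻¹ * F x) ≤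
        (M - 2⁻¹ * m) * (2⁻¹ * F x) :=
      mul_le_mul_of_nonneg_right hcoef (by linarith [hF0 x])
    have h4 : (M - 2⁻¹ * m) * (2⁻¹ * F x) = 4⁻¹ * ((2 * M - m) * F x) := by ring
    linarith
  have hFs : Torus.IsSmooth F := by
    have hD : ∀ m, Torus.IsSmooth (Torus.partialDeriv m (u t)) := fun m => hut.partialDeriv m
    have hDc : ∀ m j, Torus.IsSmooth (fun y => Torus.partialDeriv m (u t) y j) :=
      fun m j => (hD m).apply j
    have hh : ∀ i j, Torus.IsSmooth (fun x =>
        ((Torus.partialDeriv j (u t) x i + Torus.partialDeriv i (u t) x j) / 2) ^ 2) :=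
      fun i j => (((hDc j i).add (hDc i j)).div_const 2).pow 2
    unfold Torus.IsSmooth at hh ⊢
    exact ContDiff.sum fun i _ => ContDiff.sum fun j _ => hh i j
  have hdetI : Integrable (fun x => (Sd x).det) volume := by
    have h3 : Torus.IsSmooth (fun x => ∑ i, ∑ j, ∑ k,
        ((Torus.partialDeriv j (u t) x i + Torus.partialDeriv i (u t) x j) / 2) *
        ((Torus.partialDeriv k (u t) x j + Torus.partialDeriv j (u t) x k) / 2) *
        ((Torus.partialDeriv i (u t) x k + Torus.partialDeriv k (u t) x i) / 2)) := by
      have hD : ∀ m, Torus.IsSmooth (Torus.partialDeriv m (u t)) := fun m => hut.partialDeriv m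
      have hDc : ∀ m j, Torus.IsSmooth (fun y => Torus.partialDeriv m (u t) y j) :=
        fun m j => (hD m).apply j
      have hSc : ∀ i j, Torus.IsSmooth (fun x => (Torus.partialDeriv j (u t) x i +
          Torus.partialDeriv i (u t) x j) / 2) := fun i j => ((hDc j i).add (hDc i j)).div_const 2
      have hh : ∀ i j k, Torus.IsSmooth (fun x =>
          ((Torus.partialDeriv j (u t) x i + Torus.partialDeriv i (u t) x j) / 2) *
          ((Torus.partialDeriv k (u t) x j + Torus.partialDeriv j (u t) x k) / 2) *
          ((Torus.partialDeriv i (u t) x k + Torus.partialDeriv k (u t) x i) / 2)) :=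
        fun i j k => ((hSc i j).mul (hSc j k)).mul (hSc k i)
      unfold Torus.IsSmooth at hh ⊢
      exact ContDiff.sum fun i _ => ContDiff.sum fun j _ => ContDiff.sum fun k _ => hh i j k
    exact (h3.integrable.const_mul (1 / 3 : ℝ)).congr
      (Filter.Eventually.of_forall fun x => (det_strain_eq_third_sum_strain_cube hd hut hdivt x).symm)
  have hmono : ∫ x, -4 * (Sd x).det ≤ ∫ x, (2 * M - m) * F x :=
    integral_mono (hdetI.const_mul _) (hFs.integrable.const_mul _) hpt
  rw [integral_const_mul, integral_const_mul] at hmono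
  have hFint : ∫ x, F x = torusEnstrophy (u t) := integral_strainNormSq_eq_torusEnstrophy hut hdivt
  rw [hFint] at hmono
  have hSd' : (∫ x, Matrix.det (Matrix.of fun i j =>
      (Torus.partialDeriv j (u t) x i + Torus.partialDeriv i (u t) x j) / 2)) = ∫ x, (Sd x).det := rfl
  rw [hReq, hSd']
  linarith

/-- **Theorem 2.2, lower rate form** (Chae, proof of Thm 2.2: `d/dt‖ω‖² ≥ [inf λ₂⁺ − 2 sup|λ₂⁻|]‖ω‖²`,
here for `ℰ = ½‖ω‖₂²`, keeping the viscous term): under the hypotheses of the upper rate form but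
with `m ≤ λ₂⁺(t, x)` and `λ₂⁻(t, x) ≤ M` for every `x`, every one-sided derivative `R` of
`s ↦ ℰ(u s)` within `[a, b]` at `t` satisfies `−ν‖Δu(t)‖₂² + (m − 2M)·ℰ(u t) ≤ R`.
[cite: Chae2005, Thm 2.2 (proof, lower differential inequality)] -/
theorem _root_.Literature.Analysis.FunctionSpaces.Torus.IsClassicalNSSolutionOn.enstrophyRate_ge_of_middleEigenvalue_bounds
    (hd : Fintype.card d = 3) {a b ν : ℝ} {u : ℝ → UnitAddTorus d → EuclideanSpace ℝ d}
    {p : ℝ → UnitAddTorus d → ℝ} (h : Torus.IsClassicalNSSolutionOn (Icc a b) ν 0 u p)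
    (hab : a < b) {t : ℝ} (ht : t ∈ Icc a b) {m M : ℝ}
    (hm : ∀ x, ∀ hx : (Matrix.of fun i j =>
        (Torus.partialDeriv j (u t) x i + Torus.partialDeriv i (u t) x j) / 2).IsHermitian,
        m ≤ max (hx.eigenvalues₀ (Fin.cast hd.symm 1)) 0)
    (hM : ∀ x, ∀ hx : (Matrix.of fun i j =>
        (Torus.partialDeriv j (u t) x i + Torus.partialDeriv i (u t) x j) / 2).IsHermitian,
        max (-hx.eigenvalues₀ (Fin.cast hd.symm 1)) 0 ≤ M)
    (R : ℝ) (hR : HasDerivWithinAt (fun s => torusEnstrophy (u s)) R (Icc a b) t) :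
    -ν * (∫ x, ‖Torus.laplacian (u t) x‖ ^ 2) + (m - 2 * M) * torusEnstrophy (u t) ≤ R := by
  have hut : Torus.IsSmooth (u t) := h.smooth_velocity.isSmooth_slice ht
  have hdivt : Torus.IsDivFree (u t) := h.divFree t ht
  have hU : UniqueDiffWithinAt ℝ (Icc a b) t := uniqueDiffOn_Icc hab t ht
  have hbal := h.hasDerivWithinAt_torusEnstrophy_det hd hab ht
  have hReq : R = -ν * (∫ x, ‖Torus.laplacian (u t) x‖ ^ 2) -
      4 * ∫ x, Matrix.det (Matrix.of fun i j =>
        (Torus.partialDeriv j (u t) x i + Torus.partialDeriv i (u t) x j) / 2) :=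
    (hR.derivWithin hU).symm.trans (hbal.derivWithin hU)
  set Sd : UnitAddTorus d → Matrix d d ℝ := fun x => Matrix.of fun i j =>
    (Torus.partialDeriv j (u t) x i + Torus.partialDeriv i (u t) x j) / 2 with hSd
  set F : UnitAddTorus d → ℝ := fun x => ∑ i, ∑ j,
    ((Torus.partialDeriv j (u t) x i + Torus.partialDeriv i (u t) x j) / 2) ^ 2 with hF
  have hF0 : ∀ x, 0 ≤ F x := fun x =>
    Finset.sum_nonneg fun i _ => Finset.sum_nonneg fun j _ => sq_nonneg _
  have hpt : ∀ x, (m - 2 * M) * F x ≤ -4 * (Sd x).det := by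
    intro x
    have hH : (Sd x).IsHermitian := isHermitian_strainMatrix (u t) x
    have htr : (Sd x).trace = 0 := trace_strainMatrix_eq_zero hut hdivt x
    have h2 := (Chae2005.neg_det_le_and_le hd (Sd x) hH htr).1
    have hFx : ∑ i, ∑ j, Sd x i j ^ 2 = F x := by simp only [hSd, hF, Matrix.of_apply]
    rw [hFx] at h2
    have hcoef : 2⁻¹ * m - M ≤ 2⁻¹ * max (hH.eigenvalues₀ (Fin.cast hd.symm 1)) 0 -
        max (-hH.eigenvalues₀ (Fin.cast hd.symm 1)) 0 := by
      have := hm x hH; have := hM x hH; linarith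
    have h3 : (2⁻¹ * m - M) * (2⁻¹ * F x) ≤ (2⁻¹ * max (hH.eigenvalues₀ (Fin.cast hd.symm 1)) 0 -
        max (-hH.eigenvalues₀ (Fin.cast hd.symm 1)) 0) * (2⁻¹ * F x) :=
      mul_le_mul_of_nonneg_right hcoef (by linarith [hF0 x])
    have h4 : (2⁻¹ * m - M) * (2⁻¹ * F x) = 4⁻¹ * ((m - 2 * M) * F x) := by ring
    linarith
  have hFs : Torus.IsSmooth F := by
    have hD : ∀ m, Torus.IsSmooth (Torus.partialDeriv m (u t)) := fun m => hut.partialDeriv m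
    have hDc : ∀ m j, Torus.IsSmooth (fun y => Torus.partialDeriv m (u t) y j) :=
      fun m j => (hD m).apply j
    have hh : ∀ i j, Torus.IsSmooth (fun x =>
        ((Torus.partialDeriv j (u t) x i + Torus.partialDeriv i (u t) x j) / 2) ^ 2) :=
      fun i j => (((hDc j i).add (hDc i j)).div_const 2).pow 2
    unfold Torus.IsSmooth at hh ⊢
    exact ContDiff.sum fun i _ => ContDiff.sum fun j _ => hh i j
  have hdetI : Integrable (fun x => (Sd x).det) volume := by
    have h3 : Torus.IsSmooth (fun x => ∑ i, ∑ j, ∑ k,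
        ((Torus.partialDeriv j (u t) x i + Torus.partialDeriv i (u t) x j) / 2) *
        ((Torus.partialDeriv k (u t) x j + Torus.partialDeriv j (u t) x k) / 2) *
        ((Torus.partialDeriv i (u t) x k + Torus.partialDeriv k (u t) x i) / 2)) := by
      have hD : ∀ m, Torus.IsSmooth (Torus.partialDeriv m (u t)) := fun m => hut.partialDeriv m
      have hDc : ∀ m j, Torus.IsSmooth (fun y => Torus.partialDeriv m (u t) y j) :=
        fun m j => (hD m).apply j
      have hSc : ∀ i j, Torus.IsSmooth (fun x => (Torus.partialDeriv j (u t) x i +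
          Torus.partialDeriv i (u t) x j) / 2) := fun i j => ((hDc j i).add (hDc i j)).div_const 2
      have hh : ∀ i j k, Torus.IsSmooth (fun x =>
          ((Torus.partialDeriv j (u t) x i + Torus.partialDeriv i (u t) x j) / 2) *
          ((Torus.partialDeriv k (u t) x j + Torus.partialDeriv j (u t) x k) / 2) *
          ((Torus.partialDeriv i (u t) x k + Torus.partialDeriv k (u t) x i) / 2)) :=
        fun i j k => ((hSc i j).mul (hSc j k)).mul (hSc k i)
      unfold Torus.IsSmooth at hh ⊢
      exact ContDiff.sum fun i _ => ContDiff.sum fun j _ => ContDiff.sum fun k _ => hh i j k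
    exact (h3.integrable.const_mul (1 / 3 : ℝ)).congr
      (Filter.Eventually.of_forall fun x => (det_strain_eq_third_sum_strain_cube hd hut hdivt x).symm)
  have hmono : ∫ x, (m - 2 * M) * F x ≤ ∫ x, -4 * (Sd x).det :=
    integral_mono (hFs.integrable.const_mul _) (hdetI.const_mul _) hpt
  rw [integral_const_mul, integral_const_mul] at hmono
  have hFint : ∫ x, F x = torusEnstrophy (u t) := integral_strainNormSq_eq_torusEnstrophy hut hdivt
  rw [hFint] at hmono
  have hSd' : (∫ x, Matrix.det (Matrix.of fun i j =>
      (Torus.partialDeriv j (u t) x i + Torus.partialDeriv i (u t) x j) / 2)) = ∫ x, (Sd x).det := rfl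
  rw [hReq, hSd']
  linarith

/-- **Theorem 2.2, upper bound, integrated** (Chae: `‖ω(t)‖₂ ≤ ‖ω₀‖₂ exp[∫₀ᵗ(sup_x λ₂⁺ − ½ inf_x|λ₂⁻|)]`;
here squared, on a window `[a, b]`, for `ν ≥ 0` — viscosity only helps the upper bound): along a
classical solution of the unforced Navier–Stokes equations with `ν ≥ 0` on `T^d × [a, b]`
(`card d = 3`, `a < b`), if `M, m : ℝ → ℝ` are continuous on `[a, b]` with `λ₂⁺(s, x) ≤ M(s)` and
`m(s) ≤ λ₂⁻(s, x)` for all `s ∈ [a, b]` and all `x`, then for every `t ∈ [a, b]`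
`ℰ(u t) ≤ ℰ(u a) · exp(∫ₐᵗ (2M − m))` and, equivalently (`∫|ω|² = 2ℰ`),
`∫|ω(t)|² ≤ (∫|ω(a)|²) · exp(∫ₐᵗ (2M − m))`. [cite: Chae2005, Thm 2.2 (second inequality of (2.10))] -/
theorem torusEnstrophy_le_mul_exp_integral_of_middleEigenvalue_bounds (hd : Fintype.card d = 3)
    {ν a b : ℝ} (hν : 0 ≤ ν) (hab : a < b)
    {u : ℝ → UnitAddTorus d → EuclideanSpace ℝ d} {p : ℝ → UnitAddTorus d → ℝ}
    (h : Torus.IsClassicalNSSolutionOn (Icc a b) ν 0 u p)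
    {M m : ℝ → ℝ} (hMc : ContinuousOn M (Icc a b)) (hmc : ContinuousOn m (Icc a b))
    (hM : ∀ s ∈ Icc a b, ∀ x, ∀ hx : (Matrix.of fun i j =>
        (Torus.partialDeriv j (u s) x i + Torus.partialDeriv i (u s) x j) / 2).IsHermitian,
        max (hx.eigenvalues₀ (Fin.cast hd.symm 1)) 0 ≤ M s)
    (hm : ∀ s ∈ Icc a b, ∀ x, ∀ hx : (Matrix.of fun i j =>
        (Torus.partialDeriv j (u s) x i + Torus.partialDeriv i (u s) x j) / 2).IsHermitian,
        m s ≤ max (-hx.eigenvalues₀ (Fin.cast hd.symm 1)) 0)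
    {t : ℝ} (ht : t ∈ Icc a b) :
    torusEnstrophy (u t) ≤ torusEnstrophy (u a) * Real.exp (∫ s in a..t, (2 * M s - m s)) ∧
    (∫ x, torusVorticitySqAt (u t) x) ≤
      (∫ x, torusVorticitySqAt (u a) x) * Real.exp (∫ s in a..t, (2 * M s - m s)) := by
  set G : ℝ → ℝ := fun s => -ν * (∫ x, ‖Torus.laplacian (u s) x‖ ^ 2) +
      ∫ x, ⟪Torus.convect (u s) (u s) x - (0 : ℝ → UnitAddTorus d → EuclideanSpace ℝ d) s x,
        Torus.laplacian (u s) x⟫_ℝ with hG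
  have hder : ∀ s ∈ Icc a b,
      HasDerivWithinAt (fun r => torusEnstrophy (u r)) (G s) (Icc a b) s :=
    fun s hs => h.hasDerivWithinAt_half_gradNormSq hab hs
  have hle : ∀ s ∈ Icc a b, G s ≤ (2 * M s - m s) * torusEnstrophy (u s) := by
    intro s hs
    have h1 := h.enstrophyRate_le_of_middleEigenvalue_bounds hd hab hs (hM s hs) (hm s hs) (G s)
      (hder s hs)
    have hdiss : 0 ≤ ν * ∫ x, ‖Torus.laplacian (u s) x‖ ^ 2 :=
      mul_nonneg hν (integral_nonneg fun x => sq_nonneg _)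
    linarith
  have hk : ContinuousOn (fun s => 2 * M s - m s) (Icc a b) := (continuousOn_const.mul hMc).sub hmc
  have hmain := le_mul_exp_integral_of_hasDerivWithinAt_le_mul hab hder hk hle ht
  refine ⟨hmain, ?_⟩
  rw [integral_torusVorticitySqAt_eq_two_mul_torusEnstrophy (h.smooth_velocity.isSmooth_slice ht)
      (h.divFree t ht),
    integral_torusVorticitySqAt_eq_two_mul_torusEnstrophy
      (h.smooth_velocity.isSmooth_slice (left_mem_Icc.2 hab.le)) (h.divFree a (left_mem_Icc.2 hab.le))]
  have := mul_le_mul_of_nonneg_left hmain (by norm_num : (0 : ℝ) ≤ 2)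
  linarith

/-- **Theorem 2.2, lower bound, integrated** (Chae: `‖ω₀‖₂ exp[∫₀ᵗ(½ inf_x λ₂⁺ − sup_x|λ₂⁻|)] ≤ ‖ω(t)‖₂`;
here squared, on a window `[a, b]`, for Euler `ν = 0` as printed): along a classical solution of
the incompressible Euler equations on `T^d × [a, b]` (`card d = 3`, `a < b`), if `m, M : ℝ → ℝ` are
continuous on `[a, b]` with `m(s) ≤ λ₂⁺(s, x)` and `λ₂⁻(s, x) ≤ M(s)` for all `s ∈ [a, b]` and all
`x`, then for every `t ∈ [a, b]`
`ℰ(u a) · exp(∫ₐᵗ (m − 2M)) ≤ ℰ(u t)` and `(∫|ω(a)|²) · exp(∫ₐᵗ (m − 2M)) ≤ ∫|ω(t)|²`.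
[cite: Chae2005, Thm 2.2 (first inequality of (2.10))] -/
theorem mul_exp_integral_le_torusEnstrophy_of_middleEigenvalue_bounds (hd : Fintype.card d = 3)
    {a b : ℝ} (hab : a < b)
    {u : ℝ → UnitAddTorus d → EuclideanSpace ℝ d} {p : ℝ → UnitAddTorus d → ℝ}
    (h : Torus.IsClassicalNSSolutionOn (Icc a b) 0 0 u p)
    {m M : ℝ → ℝ} (hmc : ContinuousOn m (Icc a b)) (hMc : ContinuousOn M (Icc a b))
    (hm : ∀ s ∈ Icc a b, ∀ x, ∀ hx : (Matrix.of fun i j =>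
        (Torus.partialDeriv j (u s) x i + Torus.partialDeriv i (u s) x j) / 2).IsHermitian,
        m s ≤ max (hx.eigenvalues₀ (Fin.cast hd.symm 1)) 0)
    (hM : ∀ s ∈ Icc a b, ∀ x, ∀ hx : (Matrix.of fun i j =>
        (Torus.partialDeriv j (u s) x i + Torus.partialDeriv i (u s) x j) / 2).IsHermitian,
        max (-hx.eigenvalues₀ (Fin.cast hd.symm 1)) 0 ≤ M s)
    {t : ℝ} (ht : t ∈ Icc a b) :
    torusEnstrophy (u a) * Real.exp (∫ s in a..t, (m s - 2 * M s)) ≤ torusEnstrophy (u t) ∧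
    (∫ x, torusVorticitySqAt (u a) x) * Real.exp (∫ s in a..t, (m s - 2 * M s)) ≤
      ∫ x, torusVorticitySqAt (u t) x := by
  set G : ℝ → ℝ := fun s => -(0 : ℝ) * (∫ x, ‖Torus.laplacian (u s) x‖ ^ 2) +
      ∫ x, ⟪Torus.convect (u s) (u s) x - (0 : ℝ → UnitAddTorus d → EuclideanSpace ℝ d) s x,
        Torus.laplacian (u s) x⟫_ℝ with hG
  have hder : ∀ s ∈ Icc a b,
      HasDerivWithinAt (fun r => torusEnstrophy (u r)) (G s) (Icc a b) s :=
    fun s hs => h.hasDerivWithinAt_half_gradNormSq hab hs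
  have hder' : ∀ s ∈ Icc a b,
      HasDerivWithinAt (fun r => -torusEnstrophy (u r)) (-G s) (Icc a b) s :=
    fun s hs => (hder s hs).neg
  have hle : ∀ s ∈ Icc a b, -G s ≤ (m s - 2 * M s) * (-torusEnstrophy (u s)) := by
    intro s hs
    have h1 := h.enstrophyRate_ge_of_middleEigenvalue_bounds hd hab hs (hm s hs) (hM s hs) (G s)
      (hder s hs)
    have h0 : -(0 : ℝ) * (∫ x, ‖Torus.laplacian (u s) x‖ ^ 2) = 0 := by ring
    rw [h0, zero_add] at h1
    linarith
  have hk : ContinuousOn (fun s => m s - 2 * M s) (Icc a b) := hmc.sub (continuousOn_const.mul hMc)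
  have hmain := le_mul_exp_integral_of_hasDerivWithinAt_le_mul hab hder' hk hle ht
  have hmain' : torusEnstrophy (u a) * Real.exp (∫ s in a..t, (m s - 2 * M s)) ≤
      torusEnstrophy (u t) := by
    have : -torusEnstrophy (u a) * Real.exp (∫ s in a..t, (m s - 2 * M s)) =
        -(torusEnstrophy (u a) * Real.exp (∫ s in a..t, (m s - 2 * M s))) := by ring
    rw [this] at hmain
    linarith
  refine ⟨hmain', ?_⟩
  rw [integral_torusVorticitySqAt_eq_two_mul_torusEnstrophy (h.smooth_velocity.isSmooth_slice ht)
      (h.divFree t ht),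
    integral_torusVorticitySqAt_eq_two_mul_torusEnstrophy
      (h.smooth_velocity.isSmooth_slice (left_mem_Icc.2 hab.le)) (h.divFree a (left_mem_Icc.2 hab.le))]
  have := mul_le_mul_of_nonneg_left hmain' (by norm_num : (0 : ℝ) ≤ 2)
  linarith

/-- **Corollary 2.1** (Chae: if `limsup_{t→T*}‖ω(t)‖₂ = ∞` then `∫₀^{T*}‖λ₂⁺(t)‖_∞ dt = ∞`; from
`‖ω(t)‖₂ ≤ ‖ω₀‖₂ exp(∫₀ᵗ‖λ₂⁺(s)‖_∞ ds)`), periodic classical bounded form for `ν ≥ 0` (Remark 2.4: the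
same controls Navier–Stokes): a continuous majorant `M(s) ≥ 0` of `λ₂⁺(s, ·)` on `[a, b]` gives
`∫|ω(t)|² ≤ (∫|ω(a)|²) exp(2∫ₐᵗ M)` for all `t ∈ [a, b]` — no blow-up of `‖ω‖₂` on a window where
`∫‖λ₂⁺‖_∞ < ∞`. (The `ℰ`-form with hypothesis `λ₂ ≤ Λ` is Miller's Thm 1.1 at `q = ∞`, tree
`torusEnstrophy_le_mul_exp_integral_middleEigenvalueBound`.) [cite: Chae2005, Cor 2.1 and Rem 2.4] -/
theorem integral_vorticitySq_le_mul_exp_two_integral_posMiddleEigenvalueBound (hd : Fintype.card d = 3)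
    {ν a b : ℝ} (hν : 0 ≤ ν) (hab : a < b)
    {u : ℝ → UnitAddTorus d → EuclideanSpace ℝ d} {p : ℝ → UnitAddTorus d → ℝ}
    (h : Torus.IsClassicalNSSolutionOn (Icc a b) ν 0 u p)
    {M : ℝ → ℝ} (hMc : ContinuousOn M (Icc a b))
    (hM : ∀ s ∈ Icc a b, ∀ x, ∀ hx : (Matrix.of fun i j =>
        (Torus.partialDeriv j (u s) x i + Torus.partialDeriv i (u s) x j) / 2).IsHermitian,
        max (hx.eigenvalues₀ (Fin.cast hd.symm 1)) 0 ≤ M s)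
    {t : ℝ} (ht : t ∈ Icc a b) :
    (∫ x, torusVorticitySqAt (u t) x) ≤
      (∫ x, torusVorticitySqAt (u a) x) * Real.exp (2 * ∫ s in a..t, M s) := by
  have h2 := (torusEnstrophy_le_mul_exp_integral_of_middleEigenvalue_bounds hd hν hab h hMc
    continuousOn_const hM (m := fun _ => 0) (fun s _ x hx => le_max_right _ _) ht).2
  have hI : (∫ s in a..t, (2 * M s - (fun _ => (0 : ℝ)) s)) = 2 * ∫ s in a..t, M s := by
    rw [← intervalIntegral.integral_const_mul]
    exact intervalIntegral.integral_congr fun s _ => by simp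
  rwa [hI] at h2

/-! ### §4 Theorem 3.1 — the sign classes `𝒜₊` (planar stretching everywhere) and `𝒜₋`
(linear stretching everywhere), before the first zero-touching time of `λ₂` -/

/-- **Theorem 3.1 (i)** (Chae: for `v₀ ∈ 𝒜₊` and `t < T(v₀)`, i.e. as long as `λ₂ ≥ 0` everywhere,
`exp(½∫₀ᵗ inf_x|λ₂| ds) ≤ ‖ω(t)‖₂/‖ω₀‖₂ ≤ exp(∫₀ᵗ sup_x|λ₂| ds)`; here squared, Euler on a window
`[a, b]`): along a classical Euler solution on `T^d × [a, b]` (`card d = 3`, `a < b`) whose middle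
strain eigenvalue satisfies `0 ≤ m(s) ≤ λ₂(s, x) ≤ M(s)` for all `s ∈ [a, b]`, `x`, with `m, M`
continuous on `[a, b]`: for every `t ∈ [a, b]`,
`(∫|ω(a)|²) exp(∫ₐᵗ m) ≤ ∫|ω(t)|² ≤ (∫|ω(a)|²) exp(2∫ₐᵗ M)`. [cite: Chae2005, Thm 3.1 (i)] -/
theorem integral_vorticitySq_bounds_of_middleEigenvalue_nonneg (hd : Fintype.card d = 3)
    {a b : ℝ} (hab : a < b)
    {u : ℝ → UnitAddTorus d → EuclideanSpace ℝ d} {p : ℝ → UnitAddTorus d → ℝ}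
    (h : Torus.IsClassicalNSSolutionOn (Icc a b) 0 0 u p)
    {m M : ℝ → ℝ} (hmc : ContinuousOn m (Icc a b)) (hMc : ContinuousOn M (Icc a b))
    (hm0 : ∀ s ∈ Icc a b, 0 ≤ m s)
    (hmM : ∀ s ∈ Icc a b, ∀ x, ∀ hx : (Matrix.of fun i j =>
        (Torus.partialDeriv j (u s) x i + Torus.partialDeriv i (u s) x j) / 2).IsHermitian,
        m s ≤ hx.eigenvalues₀ (Fin.cast hd.symm 1) ∧ hx.eigenvalues₀ (Fin.cast hd.symm 1) ≤ M s)
    {t : ℝ} (ht : t ∈ Icc a b) :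
    (∫ x, torusVorticitySqAt (u a) x) * Real.exp (∫ s in a..t, m s) ≤ ∫ x, torusVorticitySqAt (u t) x ∧
    (∫ x, torusVorticitySqAt (u t) x) ≤
      (∫ x, torusVorticitySqAt (u a) x) * Real.exp (2 * ∫ s in a..t, M s) := by
  -- on `𝒜₊`: `λ₂⁺ = λ₂ ∈ [m, M]`, `λ₂⁻ = 0`
  have hMp : ∀ s ∈ Icc a b, ∀ x, ∀ hx : (Matrix.of fun i j =>
      (Torus.partialDeriv j (u s) x i + Torus.partialDeriv i (u s) x j) / 2).IsHermitian,
      max (hx.eigenvalues₀ (Fin.cast hd.symm 1)) 0 ≤ M s := fun s hs x hx =>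
    max_le (hmM s hs x hx).2 (le_trans (hm0 s hs) (le_trans (hmM s hs x hx).1 (hmM s hs x hx).2))
  have hmn : ∀ s ∈ Icc a b, ∀ x, ∀ hx : (Matrix.of fun i j =>
      (Torus.partialDeriv j (u s) x i + Torus.partialDeriv i (u s) x j) / 2).IsHermitian,
      (fun _ => (0 : ℝ)) s ≤ max (-hx.eigenvalues₀ (Fin.cast hd.symm 1)) 0 :=
    fun s _ x hx => le_max_right _ _
  have hmp : ∀ s ∈ Icc a b, ∀ x, ∀ hx : (Matrix.of fun i j =>
      (Torus.partialDeriv j (u s) x i + Torus.partialDeriv i (u s) x j) / 2).IsHermitian,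
      m s ≤ max (hx.eigenvalues₀ (Fin.cast hd.symm 1)) 0 :=
    fun s hs x hx => le_trans (hmM s hs x hx).1 (le_max_left _ _)
  have hMn : ∀ s ∈ Icc a b, ∀ x, ∀ hx : (Matrix.of fun i j =>
      (Torus.partialDeriv j (u s) x i + Torus.partialDeriv i (u s) x j) / 2).IsHermitian,
      max (-hx.eigenvalues₀ (Fin.cast hd.symm 1)) 0 ≤ (fun _ => (0 : ℝ)) s := fun s hs x hx =>
    max_le (by have := le_trans (hm0 s hs) (hmM s hs x hx).1; simp only; linarith) le_rfl
  have hup := (torusEnstrophy_le_mul_exp_integral_of_middleEigenvalue_bounds hd le_rfl hab h hMc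
    continuousOn_const hMp hmn ht).2
  have hlo := (mul_exp_integral_le_torusEnstrophy_of_middleEigenvalue_bounds hd hab h hmc
    continuousOn_const hmp hMn ht).2
  have hI1 : (∫ s in a..t, (2 * M s - (fun _ => (0 : ℝ)) s)) = 2 * ∫ s in a..t, M s := by
    rw [← intervalIntegral.integral_const_mul]
    exact intervalIntegral.integral_congr fun s _ => by simp
  have hI2 : (∫ s in a..t, (m s - 2 * (fun _ => (0 : ℝ)) s)) = ∫ s in a..t, m s :=
    intervalIntegral.integral_congr fun s _ => by simp
  rw [hI1] at hup
  rw [hI2] at hlo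
  exact ⟨hlo, hup⟩

/-- **Theorem 3.1 (ii)** (Chae: for `v₀ ∈ 𝒜₋` and `t < T(v₀)`, i.e. as long as `λ₂ ≤ 0` everywhere,
`exp(−∫₀ᵗ sup_x|λ₂| ds) ≤ ‖ω(t)‖₂/‖ω₀‖₂ ≤ exp(−½∫₀ᵗ inf_x|λ₂| ds)`; here squared, Euler on a
window): along a classical Euler solution on `T^d × [a, b]` (`card d = 3`, `a < b`) with
`0 ≤ m(s) ≤ −λ₂(s, x) ≤ M(s)` for all `s ∈ [a, b]`, `x`, `m, M` continuous on `[a, b]`: for every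
`t ∈ [a, b]`, `(∫|ω(a)|²) exp(−2∫ₐᵗ M) ≤ ∫|ω(t)|² ≤ (∫|ω(a)|²) exp(−∫ₐᵗ m)` — everywhere-linear
stretching makes the enstrophy DECAY. [cite: Chae2005, Thm 3.1 (ii)] -/
theorem integral_vorticitySq_bounds_of_middleEigenvalue_nonpos (hd : Fintype.card d = 3)
    {a b : ℝ} (hab : a < b)
    {u : ℝ → UnitAddTorus d → EuclideanSpace ℝ d} {p : ℝ → UnitAddTorus d → ℝ}
    (h : Torus.IsClassicalNSSolutionOn (Icc a b) 0 0 u p)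
    {m M : ℝ → ℝ} (hmc : ContinuousOn m (Icc a b)) (hMc : ContinuousOn M (Icc a b))
    (hm0 : ∀ s ∈ Icc a b, 0 ≤ m s)
    (hmM : ∀ s ∈ Icc a b, ∀ x, ∀ hx : (Matrix.of fun i j =>
        (Torus.partialDeriv j (u s) x i + Torus.partialDeriv i (u s) x j) / 2).IsHermitian,
        m s ≤ -hx.eigenvalues₀ (Fin.cast hd.symm 1) ∧ -hx.eigenvalues₀ (Fin.cast hd.symm 1) ≤ M s)
    {t : ℝ} (ht : t ∈ Icc a b) :
    (∫ x, torusVorticitySqAt (u a) x) * Real.exp (-2 * ∫ s in a..t, M s) ≤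
      ∫ x, torusVorticitySqAt (u t) x ∧
    (∫ x, torusVorticitySqAt (u t) x) ≤
      (∫ x, torusVorticitySqAt (u a) x) * Real.exp (-∫ s in a..t, m s) := by
  -- on `𝒜₋`: `λ₂⁺ = 0`, `λ₂⁻ = -λ₂ ∈ [m, M]`
  have hMp : ∀ s ∈ Icc a b, ∀ x, ∀ hx : (Matrix.of fun i j =>
      (Torus.partialDeriv j (u s) x i + Torus.partialDeriv i (u s) x j) / 2).IsHermitian,
      max (hx.eigenvalues₀ (Fin.cast hd.symm 1)) 0 ≤ (fun _ => (0 : ℝ)) s := fun s hs x hx =>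
    max_le (by have := le_trans (hm0 s hs) (hmM s hs x hx).1; simp only; linarith) le_rfl
  have hmn : ∀ s ∈ Icc a b, ∀ x, ∀ hx : (Matrix.of fun i j =>
      (Torus.partialDeriv j (u s) x i + Torus.partialDeriv i (u s) x j) / 2).IsHermitian,
      m s ≤ max (-hx.eigenvalues₀ (Fin.cast hd.symm 1)) 0 :=
    fun s hs x hx => le_trans (hmM s hs x hx).1 (le_max_left _ _)
  have hmp : ∀ s ∈ Icc a b, ∀ x, ∀ hx : (Matrix.of fun i j =>
      (Torus.partialDeriv j (u s) x i + Torus.partialDeriv i (u s) x j) / 2).IsHermitian,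
      (fun _ => (0 : ℝ)) s ≤ max (hx.eigenvalues₀ (Fin.cast hd.symm 1)) 0 :=
    fun s _ x hx => le_max_right _ _
  have hMn : ∀ s ∈ Icc a b, ∀ x, ∀ hx : (Matrix.of fun i j =>
      (Torus.partialDeriv j (u s) x i + Torus.partialDeriv i (u s) x j) / 2).IsHermitian,
      max (-hx.eigenvalues₀ (Fin.cast hd.symm 1)) 0 ≤ M s := fun s hs x hx =>
    max_le (hmM s hs x hx).2 (le_trans (hm0 s hs) (le_trans (hmM s hs x hx).1 (hmM s hs x hx).2))
  have hup := (torusEnstrophy_le_mul_exp_integral_of_middleEigenvalue_bounds hd le_rfl hab h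
    continuousOn_const hmc hMp hmn ht).2
  have hlo := (mul_exp_integral_le_torusEnstrophy_of_middleEigenvalue_bounds hd hab h
    continuousOn_const hMc hmp hMn ht).2
  have hI1 : (∫ s in a..t, (2 * (fun _ => (0 : ℝ)) s - m s)) = -∫ s in a..t, m s := by
    rw [← intervalIntegral.integral_neg]
    exact intervalIntegral.integral_congr fun s _ => by simp
  have hI2 : (∫ s in a..t, ((fun _ => (0 : ℝ)) s - 2 * M s)) = -2 * ∫ s in a..t, M s := by
    rw [← intervalIntegral.integral_const_mul]
    exact intervalIntegral.integral_congr fun s _ => by simp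
  rw [hI1] at hup
  rw [hI2] at hlo
  exact ⟨hlo, hup⟩

/-! ### §5 Theorem 3.2 — decay of the eigenvalue ratio: uniformly planar (`λ₂ ≥ eλ₁`) or uniformly
linear (`|λ₂| ≥ e|λ₃|`) stretching cannot persist; `inf ε < C/√t` -/

/-- `r^{3/2} = r√r` for `r ≥ 0`. [folklore] -/
private theorem rpow_threeHalves_eq_mul_sqrt_chae {r : ℝ} (hr : 0 ≤ r) : r ^ (3 / 2 : ℝ) = r * Real.sqrt r := by
  rw [show (3 / 2 : ℝ) = 1 + 1 / 2 by norm_num, Real.rpow_add' hr (by norm_num), Real.rpow_one,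
    Real.sqrt_eq_rpow]

/-- `r ↦ r√r` is monotone on `[0, ∞)`. [folklore] -/
private theorem mul_sqrt_self_mono_chae {r s : ℝ} (hr : 0 ≤ r) (hrs : r ≤ s) :
    r * Real.sqrt r ≤ s * Real.sqrt s :=
  mul_le_mul hrs (Real.sqrt_le_sqrt hrs) (Real.sqrt_nonneg _) (hr.trans hrs)

omit [DecidableEq d] in
/-- **Jensen step of Chae's proof of Thm 3.2** (the Hölder inequality (3.6) in the special case of a
uniform ratio bound, on the probability space `T^d`): for a continuous `f ≥ 0` on `T^d`,
`(∫f) · √(∫f) ≤ ∫ f√f` (`r ↦ r^{3/2}` is convex). [cite: Chae2005, proof of Thm 3.2, (3.6)] -/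
theorem integral_mul_sqrt_integral_le {f : UnitAddTorus d → ℝ} (hf : Continuous f) (hf0 : ∀ x, 0 ≤ f x) :
    (∫ x, f x) * Real.sqrt (∫ x, f x) ≤ ∫ x, f x * Real.sqrt (f x) := by
  have hJ := ConvexOn.map_integral_le (μ := (volume : Measure (UnitAddTorus d)))
    (convexOn_rpow (by norm_num : (1 : ℝ) ≤ 3 / 2))
    (Real.continuous_rpow_const (by norm_num : (0 : ℝ) ≤ 3 / 2)).continuousOn isClosed_Ici
    (Filter.Eventually.of_forall fun x => (hf0 x : f x ∈ Ici (0 : ℝ))) hf.integrable_unitAddTorus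
    ((Real.continuous_rpow_const (by norm_num : (0 : ℝ) ≤ 3 / 2)).comp hf).integrable_unitAddTorus
  rw [rpow_threeHalves_eq_mul_sqrt_chae (integral_nonneg hf0)] at hJ
  refine hJ.trans (le_of_eq (integral_congr_ae (Filter.Eventually.of_forall fun x => ?_)))
  exact rpow_threeHalves_eq_mul_sqrt_chae (hf0 x)

/-- **Theorem 3.2 (i), rate form** (Chae, proof of Thm 3.2 (i): (3.5)–(3.7) give
`dy/dt ≥ (2/√27)[∫ε⁻⁴]^{-1/2} y²` for `y² = ∫λ²(ε² + ε + 1) = ½∫|S|²`; here with a UNIFORM ratio bound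
`ε ≥ e` in place of `[∫ε⁻⁴]^{-1/2}`, for `ℰ = ∫|S|² = 2y²`, any `ν`): along a classical solution of the
unforced Navier–Stokes equations on `T^d × [a, b]` (`card d = 3`, `a < b`), if at time `t` the strain
eigenvalues satisfy `λ₂(t, x) ≥ e·λ₁(t, x)` for every `x` (`e ≥ 0`; planar stretching with ratio at
least `e` everywhere), then every one-sided derivative `R` of `s ↦ ℰ(u s)` within `[a, b]` at `t` obeys
`R ≥ −ν‖Δu(t)‖₂² + 8e² (ℰ/6)^{3/2}` (pointwise `−det S ≥ 2e²λ₁³ ≥ 2e²(|S|²/6)^{3/2}`, then Jensen).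
[cite: Chae2005, Thm 3.2 (i) (proof, (3.4)–(3.7))] -/
theorem _root_.Literature.Analysis.FunctionSpaces.Torus.IsClassicalNSSolutionOn.enstrophyRate_ge_of_eigenvalueRatio
    (hd : Fintype.card d = 3) {a b ν : ℝ} {u : ℝ → UnitAddTorus d → EuclideanSpace ℝ d}
    {p : ℝ → UnitAddTorus d → ℝ} (h : Torus.IsClassicalNSSolutionOn (Icc a b) ν 0 u p)
    (hab : a < b) {t : ℝ} (ht : t ∈ Icc a b) {e : ℝ} (he : 0 ≤ e)
    (hratio : ∀ x, ∀ hx : (Matrix.of fun i j =>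
        (Torus.partialDeriv j (u t) x i + Torus.partialDeriv i (u t) x j) / 2).IsHermitian,
        e * hx.eigenvalues₀ (Fin.cast hd.symm 0) ≤ hx.eigenvalues₀ (Fin.cast hd.symm 1))
    (R : ℝ) (hR : HasDerivWithinAt (fun s => torusEnstrophy (u s)) R (Icc a b) t) :
    -ν * (∫ x, ‖Torus.laplacian (u t) x‖ ^ 2) +
      8 * e ^ 2 * ((torusEnstrophy (u t) / 6) * Real.sqrt (torusEnstrophy (u t) / 6)) ≤ R := by
  have hut : Torus.IsSmooth (u t) := h.smooth_velocity.isSmooth_slice ht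
  have hdivt : Torus.IsDivFree (u t) := h.divFree t ht
  have hU : UniqueDiffWithinAt ℝ (Icc a b) t := uniqueDiffOn_Icc hab t ht
  have hbal := h.hasDerivWithinAt_torusEnstrophy_det hd hab ht
  have hReq : R = -ν * (∫ x, ‖Torus.laplacian (u t) x‖ ^ 2) -
      4 * ∫ x, Matrix.det (Matrix.of fun i j =>
        (Torus.partialDeriv j (u t) x i + Torus.partialDeriv i (u t) x j) / 2) :=
    (hR.derivWithin hU).symm.trans (hbal.derivWithin hU)
  set Sd : UnitAddTorus d → Matrix d d ℝ := fun x => Matrix.of fun i j =>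
    (Torus.partialDeriv j (u t) x i + Torus.partialDeriv i (u t) x j) / 2 with hSd
  set F : UnitAddTorus d → ℝ := fun x => ∑ i, ∑ j,
    ((Torus.partialDeriv j (u t) x i + Torus.partialDeriv i (u t) x j) / 2) ^ 2 with hF
  have hF0 : ∀ x, 0 ≤ F x := fun x =>
    Finset.sum_nonneg fun i _ => Finset.sum_nonneg fun j _ => sq_nonneg _
  -- pointwise: `-4 det S ≥ 8e²·(F/6)√(F/6)`
  have hpt : ∀ x, 8 * e ^ 2 * ((F x / 6) * Real.sqrt (F x / 6)) ≤ -4 * (Sd x).det := by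
    intro x
    have hH : (Sd x).IsHermitian := isHermitian_strainMatrix (u t) x
    have htr : (Sd x).trace = 0 := trace_strainMatrix_eq_zero hut hdivt x
    obtain ⟨hcube, hsix⟩ := Chae2005.planar_class_pointwise hd (Sd x) hH htr he (hratio x hH)
    have hl0 : 0 ≤ hH.eigenvalues₀ (Fin.cast hd.symm 0) := (Chae2005.eigenvalues_basic hd (Sd x) hH htr).1
    have hFx : ∑ i, ∑ j, Sd x i j ^ 2 = F x := by simp only [hSd, hF, Matrix.of_apply]
    rw [hFx] at hsix
    have h1 : (F x / 6) * Real.sqrt (F x / 6) ≤ hH.eigenvalues₀ (Fin.cast hd.symm 0) ^ 3 := by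
      have h2 := mul_sqrt_self_mono_chae (by linarith [hF0 x] : 0 ≤ F x / 6)
        (by linarith : F x / 6 ≤ hH.eigenvalues₀ (Fin.cast hd.symm 0) ^ 2)
      rw [Real.sqrt_sq hl0] at h2
      linarith [h2]
    nlinarith [h1, sq_nonneg e]
  -- integrate: Jensen on the probability space `T^d`
  have hFs : Torus.IsSmooth F := by
    have hD : ∀ m, Torus.IsSmooth (Torus.partialDeriv m (u t)) := fun m => hut.partialDeriv m
    have hDc : ∀ m j, Torus.IsSmooth (fun y => Torus.partialDeriv m (u t) y j) :=
      fun m j => (hD m).apply j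
    have hh : ∀ i j, Torus.IsSmooth (fun x =>
        ((Torus.partialDeriv j (u t) x i + Torus.partialDeriv i (u t) x j) / 2) ^ 2) :=
      fun i j => (((hDc j i).add (hDc i j)).div_const 2).pow 2
    unfold Torus.IsSmooth at hh ⊢
    exact ContDiff.sum fun i _ => ContDiff.sum fun j _ => hh i j
  have hF6c : Continuous fun x => F x / 6 := hFs.continuous.div_const 6
  have hJ := integral_mul_sqrt_integral_le hF6c (fun x => by linarith [hF0 x])
  have hgI : Integrable (fun x => (F x / 6) * Real.sqrt (F x / 6)) volume :=
    (hF6c.mul (Real.continuous_sqrt.comp hF6c)).integrable_unitAddTorus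
  have hdetI : Integrable (fun x => (Sd x).det) volume := by
    have h3 : Torus.IsSmooth (fun x => ∑ i, ∑ j, ∑ k,
        ((Torus.partialDeriv j (u t) x i + Torus.partialDeriv i (u t) x j) / 2) *
        ((Torus.partialDeriv k (u t) x j + Torus.partialDeriv j (u t) x k) / 2) *
        ((Torus.partialDeriv i (u t) x k + Torus.partialDeriv k (u t) x i) / 2)) := by
      have hD : ∀ m, Torus.IsSmooth (Torus.partialDeriv m (u t)) := fun m => hut.partialDeriv m
      have hDc : ∀ m j, Torus.IsSmooth (fun y => Torus.partialDeriv m (u t) y j) :=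
        fun m j => (hD m).apply j
      have hSc : ∀ i j, Torus.IsSmooth (fun x => (Torus.partialDeriv j (u t) x i +
          Torus.partialDeriv i (u t) x j) / 2) := fun i j => ((hDc j i).add (hDc i j)).div_const 2
      have hh : ∀ i j k, Torus.IsSmooth (fun x =>
          ((Torus.partialDeriv j (u t) x i + Torus.partialDeriv i (u t) x j) / 2) *
          ((Torus.partialDeriv k (u t) x j + Torus.partialDeriv j (u t) x k) / 2) *
          ((Torus.partialDeriv i (u t) x k + Torus.partialDeriv k (u t) x i) / 2)) :=
        fun i j k => ((hSc i j).mul (hSc j k)).mul (hSc k i)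
      unfold Torus.IsSmooth at hh ⊢
      exact ContDiff.sum fun i _ => ContDiff.sum fun j _ => ContDiff.sum fun k _ => hh i j k
    exact (h3.integrable.const_mul (1 / 3 : ℝ)).congr
      (Filter.Eventually.of_forall fun x => (det_strain_eq_third_sum_strain_cube hd hut hdivt x).symm)
  have hmono : ∫ x, 8 * e ^ 2 * ((F x / 6) * Real.sqrt (F x / 6)) ≤ ∫ x, -4 * (Sd x).det :=
    integral_mono (hgI.const_mul _) (hdetI.const_mul _) hpt
  rw [integral_const_mul, integral_const_mul] at hmono
  have hFint : ∫ x, F x = torusEnstrophy (u t) := integral_strainNormSq_eq_torusEnstrophy hut hdivt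
  have hI6 : (∫ x, F x / 6) = torusEnstrophy (u t) / 6 := by
    rw [show (fun x => F x / 6) = fun x => 6⁻¹ * F x from funext fun x => by ring, integral_const_mul,
      hFint]; ring
  rw [hI6] at hJ
  have hSd' : (∫ x, Matrix.det (Matrix.of fun i j =>
      (Torus.partialDeriv j (u t) x i + Torus.partialDeriv i (u t) x j) / 2)) = ∫ x, (Sd x).det := rfl
  rw [hReq, hSd']
  have he2 : 0 ≤ 8 * e ^ 2 := by positivity
  nlinarith [mul_le_mul_of_nonneg_left hJ he2, hmono]

/-- **Theorem 3.2 (i) — the eigenvalue ratio must decay** (Chae: for `v₀ ∈ 𝒜₊` there is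
`C = C(v₀, |Ω|)` with `inf_{(x,s)∈T³×(0,t)} ε(x, s) < C/√t` for `t < T(v₀)`, `ε = λ₂/λ₁`; the proof's
explicit constant `t · inf ε² < √27 |Ω|^{1/2}/‖ω₀‖₂` — the printed display carries a further factor
`2^{-1/2}` on the right coming from the slip `y² = ½‖ω‖₂²` for `y² = ∫λ²(ε²+ε+1) = ½∫|S|² = ¼‖ω‖₂²`;
the statement of the theorem is unaffected). Periodic classical form on the unit torus (`|Ω| = 1`),
Euler: if along a classical Euler solution on `T^d × [a, b]` (`card d = 3`, `a < b`) the strain has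
`λ₂(s, x) ≥ e·λ₁(s, x)` for all `s ∈ [a, b]` and all `x`, with `e > 0`, then for every `t ∈ [a, b]`
`(t − a) · e² · ‖ω(a)‖₂ < √27` and `(t − a) · e² · √ℰ(u a) < 3√6/2`:
uniformly planar stretching with ratio `≥ e` cannot persist longer than `√27/(e²‖ω(a)‖₂)`.
[cite: Chae2005, Thm 3.2 (i) with proof (3.3)–(3.7)] -/
theorem eigenvalueRatio_persistence_time_lt (hd : Fintype.card d = 3) {a b : ℝ} (hab : a < b)
    {u : ℝ → UnitAddTorus d → EuclideanSpace ℝ d} {p : ℝ → UnitAddTorus d → ℝ}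
    (h : Torus.IsClassicalNSSolutionOn (Icc a b) 0 0 u p) {e : ℝ} (he : 0 < e)
    (hratio : ∀ s ∈ Icc a b, ∀ x, ∀ hx : (Matrix.of fun i j =>
        (Torus.partialDeriv j (u s) x i + Torus.partialDeriv i (u s) x j) / 2).IsHermitian,
        e * hx.eigenvalues₀ (Fin.cast hd.symm 0) ≤ hx.eigenvalues₀ (Fin.cast hd.symm 1))
    {t : ℝ} (ht : t ∈ Icc a b) :
    (t - a) * e ^ 2 * Real.sqrt (torusEnstrophy (u a)) < 3 * Real.sqrt 6 / 2 ∧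
    (t - a) * e ^ 2 * Real.sqrt (∫ x, torusVorticitySqAt (u a) x) < Real.sqrt 27 := by
  have ha : a ∈ Icc a b := left_mem_Icc.2 hab.le
  have hta : 0 ≤ t - a := by linarith [ht.1]
  have h6 : (0 : ℝ) < Real.sqrt 6 := Real.sqrt_pos.2 (by norm_num)
  -- the vorticity form follows from the enstrophy form (`∫|ω|² = 2ℰ`, `√2 · 3√6/2 = √27`)
  have hconv : (t - a) * e ^ 2 * Real.sqrt (torusEnstrophy (u a)) < 3 * Real.sqrt 6 / 2 →
      (t - a) * e ^ 2 * Real.sqrt (∫ x, torusVorticitySqAt (u a) x) < Real.sqrt 27 := by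
    intro hE
    rw [integral_torusVorticitySqAt_eq_two_mul_torusEnstrophy (h.smooth_velocity.isSmooth_slice ha)
      (h.divFree a ha), Real.sqrt_mul (by norm_num : (0 : ℝ) ≤ 2)]
    have h27 : Real.sqrt 27 = Real.sqrt 2 * (3 * Real.sqrt 6 / 2) := by
      rw [show (27 : ℝ) = 3 ^ 2 * 3 by norm_num, Real.sqrt_mul (by norm_num), Real.sqrt_sq (by norm_num),
        show (6 : ℝ) = 2 * 3 by norm_num, Real.sqrt_mul (by norm_num)]
      have h2 : Real.sqrt 2 * Real.sqrt 2 = 2 := Real.mul_self_sqrt (by norm_num)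
      calc 3 * Real.sqrt 3 = 3 * (Real.sqrt 2 * Real.sqrt 2) * Real.sqrt 3 / 2 := by rw [h2]; ring
        _ = Real.sqrt 2 * (3 * (Real.sqrt 2 * Real.sqrt 3) / 2) := by ring
    rw [h27, show (t - a) * e ^ 2 * (Real.sqrt 2 * Real.sqrt (torusEnstrophy (u a))) =
      Real.sqrt 2 * ((t - a) * e ^ 2 * Real.sqrt (torusEnstrophy (u a))) by ring]
    exact mul_lt_mul_of_pos_left hE (Real.sqrt_pos.2 (by norm_num))
  refine ⟨?_, hconv ?_⟩ <;>
  · -- enstrophy form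
    rcases (torusEnstrophy_nonneg (u a)).eq_or_lt with hE0 | hEpos
    · rw [← hE0, Real.sqrt_zero, mul_zero]; positivity
    -- `λ₂ ≥ eλ₁ ≥ 0` everywhere: the lower Grönwall bound with rate `0` keeps `ℰ ≥ ℰ(a) > 0`
    have hmp : ∀ s ∈ Icc a b, ∀ x, ∀ hx : (Matrix.of fun i j =>
        (Torus.partialDeriv j (u s) x i + Torus.partialDeriv i (u s) x j) / 2).IsHermitian,
        (fun _ => (0 : ℝ)) s ≤ max (hx.eigenvalues₀ (Fin.cast hd.symm 1)) 0 :=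
      fun s _ x hx => le_max_right _ _
    have hMn : ∀ s ∈ Icc a b, ∀ x, ∀ hx : (Matrix.of fun i j =>
        (Torus.partialDeriv j (u s) x i + Torus.partialDeriv i (u s) x j) / 2).IsHermitian,
        max (-hx.eigenvalues₀ (Fin.cast hd.symm 1)) 0 ≤ (fun _ => (0 : ℝ)) s := by
      intro s hs x hx
      have hl0 : 0 ≤ hx.eigenvalues₀ (Fin.cast hd.symm 0) :=
        (Chae2005.eigenvalues_basic hd _ hx (trace_strainMatrix_eq_zero
          (h.smooth_velocity.isSmooth_slice hs) (h.divFree s hs) x)).1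
      have := hratio s hs x hx
      exact max_le (by simp only; nlinarith [mul_nonneg he.le hl0]) le_rfl
    have hpos : ∀ s ∈ Icc a b, 0 < torusEnstrophy (u s) := by
      intro s hs
      have hlo := (mul_exp_integral_le_torusEnstrophy_of_middleEigenvalue_bounds hd hab h
        continuousOn_const continuousOn_const hmp hMn hs).1
      have hI : (∫ r in a..s, ((fun _ => (0 : ℝ)) r - 2 * (fun _ => (0 : ℝ)) r)) = 0 := by
        simp
      rw [hI, Real.exp_zero, mul_one] at hlo
      exact lt_of_lt_of_le hEpos hlo
    -- derivative values of `ℰ` and of `z = 1/√ℰ`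
    set G : ℝ → ℝ := fun s => -(0 : ℝ) * (∫ x, ‖Torus.laplacian (u s) x‖ ^ 2) +
        ∫ x, ⟪Torus.convect (u s) (u s) x - (0 : ℝ → UnitAddTorus d → EuclideanSpace ℝ d) s x,
          Torus.laplacian (u s) x⟫_ℝ with hG
    have hder : ∀ s ∈ Icc a b,
        HasDerivWithinAt (fun r => torusEnstrophy (u r)) (G s) (Icc a b) s :=
      fun s hs => h.hasDerivWithinAt_half_gradNormSq hab hs
    set c : ℝ := 2 * e ^ 2 / (3 * Real.sqrt 6) with hc
    have hrate : ∀ s ∈ Icc a b,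
        8 * e ^ 2 * ((torusEnstrophy (u s) / 6) * Real.sqrt (torusEnstrophy (u s) / 6)) ≤ G s := by
      intro s hs
      have h1 := h.enstrophyRate_ge_of_eigenvalueRatio hd hab hs he.le (hratio s hs) (G s) (hder s hs)
      have h0 : -(0 : ℝ) * (∫ x, ‖Torus.laplacian (u s) x‖ ^ 2) = 0 := by ring
      rw [h0, zero_add] at h1
      exact h1
    set z : ℝ → ℝ := fun s => (Real.sqrt (torusEnstrophy (u s)))⁻¹ with hz
    set z' : ℝ → ℝ := fun s => -(G s / (2 * Real.sqrt (torusEnstrophy (u s)))) /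
        Real.sqrt (torusEnstrophy (u s)) ^ 2 with hz'
    have hzder : ∀ s ∈ Icc a b, HasDerivWithinAt z (z' s) (Icc a b) s := by
      intro s hs
      have hsq := (hder s hs).sqrt (hpos s hs).ne'
      exact hsq.inv (Real.sqrt_pos.2 (hpos s hs)).ne'
    have hz'le : ∀ s ∈ Icc a b, z' s ≤ -c := by
      intro s hs
      have hEs := hpos s hs
      have hr : 0 < Real.sqrt (torusEnstrophy (u s)) := Real.sqrt_pos.2 hEs
      have hr2 : Real.sqrt (torusEnstrophy (u s)) ^ 2 = torusEnstrophy (u s) := Real.sq_sqrt hEs.le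
      have hr6 : Real.sqrt (torusEnstrophy (u s) / 6) = Real.sqrt (torusEnstrophy (u s)) / Real.sqrt 6 := by
        rw [Real.sqrt_div' _ (by norm_num : (0:ℝ) ≤ 6)]
      have hG := hrate s hs
      rw [hr6] at hG
      -- `z' = -G/(2ℰ√ℰ) ≤ -8e²(ℰ/6)(√ℰ/√6)/(2ℰ√ℰ) = -2e²/(3√6)`
      have hz's : z' s = -(G s) / (2 * torusEnstrophy (u s) * Real.sqrt (torusEnstrophy (u s))) := by
        simp only [hz']
        rw [hr2]
        field_simp
      rw [hz's, hc, div_le_iff₀ (by positivity), neg_mul, neg_le_neg_iff]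
      have h66 : Real.sqrt 6 * Real.sqrt 6 = 6 := Real.mul_self_sqrt (by norm_num)
      have key : 2 * e ^ 2 / (3 * Real.sqrt 6) * (2 * torusEnstrophy (u s) * Real.sqrt (torusEnstrophy (u s)))
          = 8 * e ^ 2 * (torusEnstrophy (u s) / 6 * (Real.sqrt (torusEnstrophy (u s)) / Real.sqrt 6)) := by
        field_simp
        nlinarith [h66]
      rw [key]
      exact hG
    -- `w = z + c(s - a)` is non-increasing on `[a, b]`
    set w : ℝ → ℝ := fun s => z s + c * (s - a) with hw
    have hwder : ∀ s ∈ Icc a b, HasDerivWithinAt w (z' s + c) (Icc a b) s := by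
      intro s hs
      have h1 : HasDerivWithinAt (fun r => c * (r - a)) (c * 1) (Icc a b) s :=
        ((hasDerivWithinAt_id s _).sub_const a).const_mul c
      rw [mul_one] at h1
      exact (hzder s hs).add h1
    have hanti : AntitoneOn w (Icc a b) := by
      refine antitoneOn_of_hasDerivWithinAt_nonpos (convex_Icc a b)
        (fun s hs => (hwder s hs).continuousWithinAt) (f' := fun s => z' s + c) ?_ ?_
      · intro s hs
        rw [interior_Icc] at hs ⊢
        exact (hwder s (Ioo_subset_Icc_self hs)).mono Ioo_subset_Icc_self
      · intro s hs
        rw [interior_Icc] at hs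
        have := hz'le s (Ioo_subset_Icc_self hs)
        linarith
    have hwt : w t ≤ w a := hanti ha ht ht.1
    have hza : w a = z a := by simp only [hw, sub_self, mul_zero, add_zero]
    have hzt : 0 < z t := by simp only [hz]; exact inv_pos.2 (Real.sqrt_pos.2 (hpos t ht))
    have hmain : c * (t - a) < (Real.sqrt (torusEnstrophy (u a)))⁻¹ := by
      have : z t + c * (t - a) ≤ z a := by rw [← hza]; exact hwt
      simp only [hz] at this ⊢
      linarith
    -- unwind: `c(t-a) < 1/√ℰ(a)` ⇒ `(t-a)e²√ℰ(a) < 3√6/2`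
    have hra : 0 < Real.sqrt (torusEnstrophy (u a)) := Real.sqrt_pos.2 hEpos
    have hmain' : c * (t - a) * Real.sqrt (torusEnstrophy (u a)) < 1 := by
      have := mul_lt_mul_of_pos_right hmain hra
      rwa [inv_mul_cancel₀ hra.ne'] at this
    rw [hc] at hmain'
    have : (t - a) * e ^ 2 * Real.sqrt (torusEnstrophy (u a)) =
        (3 * Real.sqrt 6 / 2) * (2 * e ^ 2 / (3 * Real.sqrt 6) * (t - a) * Real.sqrt (torusEnstrophy (u a))) := by
      field_simp
    rw [this]
    have h32 : (0 : ℝ) < 3 * Real.sqrt 6 / 2 := by positivity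
    calc (3 * Real.sqrt 6 / 2) * (2 * e ^ 2 / (3 * Real.sqrt 6) * (t - a) * Real.sqrt (torusEnstrophy (u a)))
        < (3 * Real.sqrt 6 / 2) * 1 := mul_lt_mul_of_pos_left hmain' h32
      _ = 3 * Real.sqrt 6 / 2 := mul_one _

/-- **Theorem 3.2 (ii), rate form** (Chae, proof of Thm 3.2 (ii): (3.8)–(3.9) give
`d/dt ∫λ²(ε²+ε+1) ≤ −(2/√27)[∫ε⁻⁴]^{-1/2}[∫λ²(ε²+ε+1)]^{3/2}` on the linear-stretching class; here with a
uniform ratio bound, for `ℰ`, any `ν`): along a classical solution of the unforced Navier–Stokes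
equations on `T^d × [a, b]` (`card d = 3`, `a < b`), if at time `t` the strain eigenvalues satisfy
`|λ₂(t, x)| ≥ e|λ₃(t, x)|` in the form `e·(−λ₃) ≤ −λ₂` for every `x` (`e ≥ 0`; linear stretching with
ratio at least `e` everywhere), then every one-sided derivative `R` of `s ↦ ℰ(u s)` within `[a, b]`
at `t` obeys `R ≤ −ν‖Δu(t)‖₂² − 8e²(ℰ/6)^{3/2}` — the enstrophy DECAYS at a definite superlinear rate.
[cite: Chae2005, Thm 3.2 (ii) (proof, (3.8)–(3.9))] -/
theorem _root_.Literature.Analysis.FunctionSpaces.Torus.IsClassicalNSSolutionOn.enstrophyRate_le_of_eigenvalueRatio_bot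
    (hd : Fintype.card d = 3) {a b ν : ℝ} {u : ℝ → UnitAddTorus d → EuclideanSpace ℝ d}
    {p : ℝ → UnitAddTorus d → ℝ} (h : Torus.IsClassicalNSSolutionOn (Icc a b) ν 0 u p)
    (hab : a < b) {t : ℝ} (ht : t ∈ Icc a b) {e : ℝ} (he : 0 ≤ e)
    (hratio : ∀ x, ∀ hx : (Matrix.of fun i j =>
        (Torus.partialDeriv j (u t) x i + Torus.partialDeriv i (u t) x j) / 2).IsHermitian,
        e * -hx.eigenvalues₀ (Fin.cast hd.symm 2) ≤ -hx.eigenvalues₀ (Fin.cast hd.symm 1))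
    (R : ℝ) (hR : HasDerivWithinAt (fun s => torusEnstrophy (u s)) R (Icc a b) t) :
    R ≤ -ν * (∫ x, ‖Torus.laplacian (u t) x‖ ^ 2) -
      8 * e ^ 2 * ((torusEnstrophy (u t) / 6) * Real.sqrt (torusEnstrophy (u t) / 6)) := by
  have hut : Torus.IsSmooth (u t) := h.smooth_velocity.isSmooth_slice ht
  have hdivt : Torus.IsDivFree (u t) := h.divFree t ht
  have hU : UniqueDiffWithinAt ℝ (Icc a b) t := uniqueDiffOn_Icc hab t ht
  have hbal := h.hasDerivWithinAt_torusEnstrophy_det hd hab ht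
  have hReq : R = -ν * (∫ x, ‖Torus.laplacian (u t) x‖ ^ 2) -
      4 * ∫ x, Matrix.det (Matrix.of fun i j =>
        (Torus.partialDeriv j (u t) x i + Torus.partialDeriv i (u t) x j) / 2) :=
    (hR.derivWithin hU).symm.trans (hbal.derivWithin hU)
  set Sd : UnitAddTorus d → Matrix d d ℝ := fun x => Matrix.of fun i j =>
    (Torus.partialDeriv j (u t) x i + Torus.partialDeriv i (u t) x j) / 2 with hSd
  set F : UnitAddTorus d → ℝ := fun x => ∑ i, ∑ j,
    ((Torus.partialDeriv j (u t) x i + Torus.partialDeriv i (u t) x j) / 2) ^ 2 with hF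
  have hF0 : ∀ x, 0 ≤ F x := fun x =>
    Finset.sum_nonneg fun i _ => Finset.sum_nonneg fun j _ => sq_nonneg _
  -- pointwise: `-4 det S ≤ -8e²·(F/6)√(F/6)`
  have hpt : ∀ x, -4 * (Sd x).det ≤ -(8 * e ^ 2 * ((F x / 6) * Real.sqrt (F x / 6))) := by
    intro x
    have hH : (Sd x).IsHermitian := isHermitian_strainMatrix (u t) x
    have htr : (Sd x).trace = 0 := trace_strainMatrix_eq_zero hut hdivt x
    obtain ⟨hcube, hsix⟩ := Chae2005.linear_class_pointwise hd (Sd x) hH htr he (hratio x hH)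
    have hl0 : 0 ≤ -hH.eigenvalues₀ (Fin.cast hd.symm 2) := by
      linarith [(Chae2005.eigenvalues_basic hd (Sd x) hH htr).2.1]
    have hFx : ∑ i, ∑ j, Sd x i j ^ 2 = F x := by simp only [hSd, hF, Matrix.of_apply]
    rw [hFx] at hsix
    have h1 : (F x / 6) * Real.sqrt (F x / 6) ≤ (-hH.eigenvalues₀ (Fin.cast hd.symm 2)) ^ 3 := by
      have h2 := mul_sqrt_self_mono_chae (by linarith [hF0 x] : 0 ≤ F x / 6)
        (by nlinarith : F x / 6 ≤ (-hH.eigenvalues₀ (Fin.cast hd.symm 2)) ^ 2)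
      rw [Real.sqrt_sq hl0] at h2
      linarith [h2]
    nlinarith [h1, sq_nonneg e]
  -- integrate: Jensen on the probability space `T^d`
  have hFs : Torus.IsSmooth F := by
    have hD : ∀ m, Torus.IsSmooth (Torus.partialDeriv m (u t)) := fun m => hut.partialDeriv m
    have hDc : ∀ m j, Torus.IsSmooth (fun y => Torus.partialDeriv m (u t) y j) :=
      fun m j => (hD m).apply j
    have hh : ∀ i j, Torus.IsSmooth (fun x =>
        ((Torus.partialDeriv j (u t) x i + Torus.partialDeriv i (u t) x j) / 2) ^ 2) :=
      fun i j => (((hDc j i).add (hDc i j)).div_const 2).pow 2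
    unfold Torus.IsSmooth at hh ⊢
    exact ContDiff.sum fun i _ => ContDiff.sum fun j _ => hh i j
  have hF6c : Continuous fun x => F x / 6 := hFs.continuous.div_const 6
  have hJ := integral_mul_sqrt_integral_le hF6c (fun x => by linarith [hF0 x])
  have hgI : Integrable (fun x => (F x / 6) * Real.sqrt (F x / 6)) volume :=
    (hF6c.mul (Real.continuous_sqrt.comp hF6c)).integrable_unitAddTorus
  have hdetI : Integrable (fun x => (Sd x).det) volume := by
    have h3 : Torus.IsSmooth (fun x => ∑ i, ∑ j, ∑ k,
        ((Torus.partialDeriv j (u t) x i + Torus.partialDeriv i (u t) x j) / 2) *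
        ((Torus.partialDeriv k (u t) x j + Torus.partialDeriv j (u t) x k) / 2) *
        ((Torus.partialDeriv i (u t) x k + Torus.partialDeriv k (u t) x i) / 2)) := by
      have hD : ∀ m, Torus.IsSmooth (Torus.partialDeriv m (u t)) := fun m => hut.partialDeriv m
      have hDc : ∀ m j, Torus.IsSmooth (fun y => Torus.partialDeriv m (u t) y j) :=
        fun m j => (hD m).apply j
      have hSc : ∀ i j, Torus.IsSmooth (fun x => (Torus.partialDeriv j (u t) x i +
          Torus.partialDeriv i (u t) x j) / 2) := fun i j => ((hDc j i).add (hDc i j)).div_const 2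
      have hh : ∀ i j k, Torus.IsSmooth (fun x =>
          ((Torus.partialDeriv j (u t) x i + Torus.partialDeriv i (u t) x j) / 2) *
          ((Torus.partialDeriv k (u t) x j + Torus.partialDeriv j (u t) x k) / 2) *
          ((Torus.partialDeriv i (u t) x k + Torus.partialDeriv k (u t) x i) / 2)) :=
        fun i j k => ((hSc i j).mul (hSc j k)).mul (hSc k i)
      unfold Torus.IsSmooth at hh ⊢
      exact ContDiff.sum fun i _ => ContDiff.sum fun j _ => ContDiff.sum fun k _ => hh i j k
    exact (h3.integrable.const_mul (1 / 3 : ℝ)).congr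
      (Filter.Eventually.of_forall fun x => (det_strain_eq_third_sum_strain_cube hd hut hdivt x).symm)
  have hmono : ∫ x, -4 * (Sd x).det ≤ ∫ x, -(8 * e ^ 2 * ((F x / 6) * Real.sqrt (F x / 6))) :=
    integral_mono (hdetI.const_mul _) (hgI.const_mul _).neg hpt
  rw [integral_const_mul, integral_neg, integral_const_mul] at hmono
  have hFint : ∫ x, F x = torusEnstrophy (u t) := integral_strainNormSq_eq_torusEnstrophy hut hdivt
  have hI6 : (∫ x, F x / 6) = torusEnstrophy (u t) / 6 := by
    rw [show (fun x => F x / 6) = fun x => 6⁻¹ * F x from funext fun x => by ring, integral_const_mul,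
      hFint]; ring
  rw [hI6] at hJ
  have hSd' : (∫ x, Matrix.det (Matrix.of fun i j =>
      (Torus.partialDeriv j (u t) x i + Torus.partialDeriv i (u t) x j) / 2)) = ∫ x, (Sd x).det := rfl
  rw [hReq, hSd']
  have he2 : 0 ≤ 8 * e ^ 2 := by positivity
  nlinarith [mul_le_mul_of_nonneg_left hJ he2, hmono]

/-- **Theorem 3.2 (ii) — decay law and ratio decay on the linear-stretching class** (Chae: for
`v₀ ∈ 𝒜₋`, `ε = |λ₂|/|λ₃|`, the proof gives (3.10)
`‖ω(t)‖₂ ≤ √2‖ω₀‖₂/(√2 + (2‖ω₀‖₂/√27)∫₀ᵗ[∫ε⁻⁴]^{-1/2})` and then, with the helicity and energy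
conservation `H₀ ≤ ‖v‖₂‖ω‖₂ = √(2E₀)‖ω(t)‖₂` as a floor for `‖ω(t)‖₂`, `t·inf ε² ≤ C(v₀, |Ω|)`).
Periodic classical form, uniform ratio, Euler: if along a classical Euler solution on `T^d × [a, b]`
(`card d = 3`, `a < b`) the strain has `e·(−λ₃) ≤ −λ₂` (`e > 0`) everywhere on the window and
`ℰ(u s) > 0` for `s ∈ [a, b]`, then for every `t ∈ [a, b]`:
(1) the DECAY LAW `1/√ℰ(u a) + (2e²/(3√6))(t − a) ≤ 1/√ℰ(u t)` (the uniform-ratio form of (3.10));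
(2) for any floor `0 < ℓ ≤ ℰ(u s)` (`s ∈ [a, b]`), `(t − a)·e² < 3√6/(2√ℓ)` — Chae's floor is
`ℓ = H₀²/(4E₀)` from helicity and energy conservation (that instantiation, which needs `H₀ ≠ 0`, is
not typed here). [cite: Chae2005, Thm 3.2 (ii) with proof (3.8)–(3.13)] -/
theorem eigenvalueRatio_bot_decay_and_persistence (hd : Fintype.card d = 3) {a b : ℝ} (hab : a < b)
    {u : ℝ → UnitAddTorus d → EuclideanSpace ℝ d} {p : ℝ → UnitAddTorus d → ℝ}
    (h : Torus.IsClassicalNSSolutionOn (Icc a b) 0 0 u p) {e : ℝ} (he : 0 < e)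
    (hratio : ∀ s ∈ Icc a b, ∀ x, ∀ hx : (Matrix.of fun i j =>
        (Torus.partialDeriv j (u s) x i + Torus.partialDeriv i (u s) x j) / 2).IsHermitian,
        e * -hx.eigenvalues₀ (Fin.cast hd.symm 2) ≤ -hx.eigenvalues₀ (Fin.cast hd.symm 1))
    (hpos : ∀ s ∈ Icc a b, 0 < torusEnstrophy (u s)) {t : ℝ} (ht : t ∈ Icc a b) :
    ((Real.sqrt (torusEnstrophy (u a)))⁻¹ + 2 * e ^ 2 / (3 * Real.sqrt 6) * (t - a) ≤
      (Real.sqrt (torusEnstrophy (u t)))⁻¹) ∧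
    (∀ ℓ : ℝ, 0 < ℓ → (∀ s ∈ Icc a b, ℓ ≤ torusEnstrophy (u s)) →
      (t - a) * e ^ 2 < 3 * Real.sqrt 6 / (2 * Real.sqrt ℓ)) := by
  have ha : a ∈ Icc a b := left_mem_Icc.2 hab.le
  have h6 : (0 : ℝ) < Real.sqrt 6 := Real.sqrt_pos.2 (by norm_num)
  -- derivative values of `ℰ` and of `z = 1/√ℰ`
  set G : ℝ → ℝ := fun s => -(0 : ℝ) * (∫ x, ‖Torus.laplacian (u s) x‖ ^ 2) +
      ∫ x, ⟪Torus.convect (u s) (u s) x - (0 : ℝ → UnitAddTorus d → EuclideanSpace ℝ d) s x,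
        Torus.laplacian (u s) x⟫_ℝ with hG
  have hder : ∀ s ∈ Icc a b,
      HasDerivWithinAt (fun r => torusEnstrophy (u r)) (G s) (Icc a b) s :=
    fun s hs => h.hasDerivWithinAt_half_gradNormSq hab hs
  set c : ℝ := 2 * e ^ 2 / (3 * Real.sqrt 6) with hc
  have hrate : ∀ s ∈ Icc a b,
      G s ≤ -(8 * e ^ 2 * ((torusEnstrophy (u s) / 6) * Real.sqrt (torusEnstrophy (u s) / 6))) := by
    intro s hs
    have h1 := h.enstrophyRate_le_of_eigenvalueRatio_bot hd hab hs he.le (hratio s hs) (G s) (hder s hs)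
    have h0 : -(0 : ℝ) * (∫ x, ‖Torus.laplacian (u s) x‖ ^ 2) = 0 := by ring
    rw [h0, zero_sub] at h1
    exact h1
  set z : ℝ → ℝ := fun s => (Real.sqrt (torusEnstrophy (u s)))⁻¹ with hz
  set z' : ℝ → ℝ := fun s => -(G s / (2 * Real.sqrt (torusEnstrophy (u s)))) /
      Real.sqrt (torusEnstrophy (u s)) ^ 2 with hz'
  have hzder : ∀ s ∈ Icc a b, HasDerivWithinAt z (z' s) (Icc a b) s := by
    intro s hs
    have hsq := (hder s hs).sqrt (hpos s hs).ne'
    exact hsq.inv (Real.sqrt_pos.2 (hpos s hs)).ne'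
  have hz'ge : ∀ s ∈ Icc a b, c ≤ z' s := by
    intro s hs
    have hEs := hpos s hs
    have hr : 0 < Real.sqrt (torusEnstrophy (u s)) := Real.sqrt_pos.2 hEs
    have hr2 : Real.sqrt (torusEnstrophy (u s)) ^ 2 = torusEnstrophy (u s) := Real.sq_sqrt hEs.le
    have hr6 : Real.sqrt (torusEnstrophy (u s) / 6) = Real.sqrt (torusEnstrophy (u s)) / Real.sqrt 6 := by
      rw [Real.sqrt_div' _ (by norm_num : (0:ℝ) ≤ 6)]
    have hG := hrate s hs
    rw [hr6] at hG
    have hz's : z' s = -(G s) / (2 * torusEnstrophy (u s) * Real.sqrt (torusEnstrophy (u s))) := by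
      simp only [hz']
      rw [hr2]
      field_simp
    rw [hz's, hc, le_div_iff₀ (by positivity)]
    have h66 : Real.sqrt 6 * Real.sqrt 6 = 6 := Real.mul_self_sqrt (by norm_num)
    have key : 2 * e ^ 2 / (3 * Real.sqrt 6) * (2 * torusEnstrophy (u s) * Real.sqrt (torusEnstrophy (u s)))
        = 8 * e ^ 2 * (torusEnstrophy (u s) / 6 * (Real.sqrt (torusEnstrophy (u s)) / Real.sqrt 6)) := by
      field_simp
      nlinarith [h66]
    rw [key]
    linarith
  -- `w = z - c(s - a)` is non-decreasing on `[a, b]`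
  set w : ℝ → ℝ := fun s => z s - c * (s - a) with hw
  have hwder : ∀ s ∈ Icc a b, HasDerivWithinAt w (z' s - c) (Icc a b) s := by
    intro s hs
    have h1 : HasDerivWithinAt (fun r => c * (r - a)) (c * 1) (Icc a b) s :=
      ((hasDerivWithinAt_id s _).sub_const a).const_mul c
    rw [mul_one] at h1
    exact (hzder s hs).sub h1
  have hmonot : MonotoneOn w (Icc a b) := by
    refine monotoneOn_of_hasDerivWithinAt_nonneg (convex_Icc a b)
      (fun s hs => (hwder s hs).continuousWithinAt) (f' := fun s => z' s - c) ?_ ?_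
    · intro s hs
      rw [interior_Icc] at hs ⊢
      exact (hwder s (Ioo_subset_Icc_self hs)).mono Ioo_subset_Icc_self
    · intro s hs
      rw [interior_Icc] at hs
      have := hz'ge s (Ioo_subset_Icc_self hs)
      linarith
  have hwt : w a ≤ w t := hmonot ha ht ht.1
  have hza : w a = z a := by simp only [hw, sub_self, mul_zero, sub_zero]
  have hdecay : (Real.sqrt (torusEnstrophy (u a)))⁻¹ + c * (t - a) ≤
      (Real.sqrt (torusEnstrophy (u t)))⁻¹ := by
    have : z a ≤ z t - c * (t - a) := by rw [← hza]; exact hwt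
    simp only [hz] at this ⊢
    linarith
  refine ⟨by rw [hc] at hdecay; exact hdecay, fun ℓ hℓ hfloor => ?_⟩
  -- with a floor `ℓ ≤ ℰ`: `c(t-a) ≤ 1/√ℰ(t) - 1/√ℰ(a) < 1/√ℓ`
  have hra : 0 < Real.sqrt (torusEnstrophy (u a)) := Real.sqrt_pos.2 (hpos a ha)
  have hℓt : (Real.sqrt (torusEnstrophy (u t)))⁻¹ ≤ (Real.sqrt ℓ)⁻¹ :=
    inv_anti₀ (Real.sqrt_pos.2 hℓ) (Real.sqrt_le_sqrt (hfloor t ht))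
  have hmain : c * (t - a) < (Real.sqrt ℓ)⁻¹ := by
    have := inv_pos.2 hra
    linarith
  rw [hc] at hmain
  have hℓr : 0 < Real.sqrt ℓ := Real.sqrt_pos.2 hℓ
  have : (t - a) * e ^ 2 = (3 * Real.sqrt 6 / 2) * (2 * e ^ 2 / (3 * Real.sqrt 6) * (t - a)) := by
    field_simp
  rw [this, show 3 * Real.sqrt 6 / (2 * Real.sqrt ℓ) = (3 * Real.sqrt 6 / 2) * (Real.sqrt ℓ)⁻¹ by
    field_simp]
  exact mul_lt_mul_of_pos_left hmain (by positivity)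

namespace Chae2005

/-! ### §6 Pointwise comparison of the sorted eigenvalues with `|S|²` (consequences of `(basic)` and
`(2.8a)`), and the exact one-snapshot form of the enstrophy balance -/

section Algebra2

variable {a b c : ℝ}

/-- `a² + b² + c² ≤ 6a²` for `a ≥ b ≥ c`, `a + b + c = 0` — no sign condition on `b`
(`|S|² ≤ 6λ₁²`, equality at `(1, 1, −2)`); from `(2.8a)` `∑λ² = 2(λ₁² + λ₁λ₂ + λ₂²)` and
`(basic)` `|λ₂| ≤ λ₁`. [cite: Chae2005, proof of Thm 2.2 ((basic), (2.8a))] -/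
theorem sum_sq_le_six_mul_top_sq (hab : b ≤ a) (hbc : c ≤ b) (h : a + b + c = 0) :
    a ^ 2 + b ^ 2 + c ^ 2 ≤ 6 * a ^ 2 := by
  have hc : c = -a - b := by linarith
  subst hc
  nlinarith [mul_nonneg (by linarith : (0:ℝ) ≤ a - b) (by linarith : (0:ℝ) ≤ 2 * a + b)]

/-- `a² + b² + c² ≤ 6c²` for `a ≥ b ≥ c`, `a + b + c = 0` (`|S|² ≤ 6λ₃²`, equality at `(2, −1, −1)`).
[cite: Chae2005, proof of Thm 2.2 ((basic), (2.8a))] -/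
theorem sum_sq_le_six_mul_bot_sq (hab : b ≤ a) (hbc : c ≤ b) (h : a + b + c = 0) :
    a ^ 2 + b ^ 2 + c ^ 2 ≤ 6 * c ^ 2 := by
  have := sum_sq_le_six_mul_top_sq (a := -c) (b := -b) (c := -a) (by linarith) (by linarith)
    (by linarith)
  linarith

/-- `(3/2)a² ≤ a² + b² + c²` for `a ≥ b ≥ c`, `a + b + c = 0` (`λ₁² ≤ ⅔|S|²`, equality at
`(2, −1, −1)`: the largest eigenvalue is at most `√(2/3)|S|`). The ordering hypothesis `hbc` is not
needed for the inequality (`a² + b² + (a + b)² − (3/2)a² = ½(a + 2b)² ≥ 0` for all real `a`, `b`);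
it is kept so that the signature matches its sorted-eigenvalue use below.
[cite: Chae2005, proof of Thm 2.2 ((basic), (2.8a))] -/
theorem three_halves_top_sq_le_sum_sq (hbc : c ≤ b) (h : a + b + c = 0) :
    3 / 2 * a ^ 2 ≤ a ^ 2 + b ^ 2 + c ^ 2 := by
  have hc : c = -a - b := by linarith
  subst hc
  nlinarith [sq_nonneg (a + 2 * b)]

/-- `(3/2)c² ≤ a² + b² + c²` for `a ≥ b ≥ c`, `a + b + c = 0` (`λ₃² ≤ ⅔|S|²`, equality at
`(1, 1, −2)`). As for the previous lemma, the ordering hypothesis `hab` is not needed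
(`½(c + 2b)² ≥ 0`) and is kept for the signature only.
[cite: Chae2005, proof of Thm 2.2 ((basic), (2.8a))] -/
theorem three_halves_bot_sq_le_sum_sq (hab : b ≤ a) (h : a + b + c = 0) :
    3 / 2 * c ^ 2 ≤ a ^ 2 + b ^ 2 + c ^ 2 := by
  have ha : a = -b - c := by linarith
  subst ha
  nlinarith [sq_nonneg (c + 2 * b)]

/-- `6b² ≤ a² + b² + c²` for `a ≥ b ≥ c`, `a + b + c = 0` — the middle eigenvalue carries at most a
sixth of `|S|²`: `λ₂² ≤ |S|²/6`, i.e. `0 ≤ λ₂⁺ ≤ |S|/√6`. Equality cases, in THIS file's DESCENDING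
order `λ₁ ≥ λ₂ ≥ λ₃`: `a² + b² + c² − 6b² = 2(a − b)(b − c)` under `a + b + c = 0`, so
`6λ₂² = |S|²` iff `λ₁ = λ₂` or `λ₂ = λ₃`, and `λ₂⁺ = |S|/√6` iff `λ₁ = λ₂` (witness `(1, 1, −2)`);
Miller–Sawyer's "equality iff `λ₂ = λ₃`" (display before (1.40)) refers to their ASCENDING order
`λ₁ ≤ λ₂ ≤ λ₃` and is the same statement.
[cite: MillerSawyer2023, proof of Thm 1.19 = 3.5 (`0 ≤ λ₂⁺ ≤ |S|/√6`)] -/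
theorem six_mul_middle_sq_le_sum_sq (hab : b ≤ a) (hbc : c ≤ b) (h : a + b + c = 0) :
    6 * b ^ 2 ≤ a ^ 2 + b ^ 2 + c ^ 2 := by
  have hc : c = -a - b := by linarith
  subst hc
  rcases le_or_gt 0 b with hb | hb
  · nlinarith [mul_nonneg hb (by linarith : (0:ℝ) ≤ a - b), mul_nonneg (by linarith : (0:ℝ) ≤ a) (by linarith : (0:ℝ) ≤ a - b)]
  · nlinarith [mul_nonneg (by linarith : (0:ℝ) ≤ -b) (by linarith : (0:ℝ) ≤ a + 2 * b),
      mul_nonneg (by linarith : (0:ℝ) ≤ a + b) (by linarith : (0:ℝ) ≤ a + 2 * b)]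

end Algebra2

section Matrix3b

variable {n : Type*} [Fintype n] [DecidableEq n]

/-- **Sorted eigenvalues versus `|M|²`** for a real symmetric trace-free matrix over a `3`-element
index type (`λ₁ = eigenvalues₀ 0 ≥ λ₂ ≥ λ₃ = eigenvalues₀ 2`, `|M|² = ∑ᵢⱼ Mᵢⱼ²`):
`|M|²/6 ≤ λ₁² ≤ ⅔|M|²`, `|M|²/6 ≤ λ₃² ≤ ⅔|M|²`, `λ₂² ≤ |M|²/6` (all sharp: `(1,1,−2)`, `(2,−1,−1)`
up to scale). [cite: Chae2005, proof of Thm 2.2 ((basic), (2.8a)); MillerSawyer2023, proof of Thm 3.5] -/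
theorem eigenvalues_sq_vs_sum_sq (hn : Fintype.card n = 3) (M : Matrix n n ℝ) (hH : M.IsHermitian)
    (htr : M.trace = 0) :
    ∑ i, ∑ j, M i j ^ 2 ≤ 6 * hH.eigenvalues₀ (Fin.cast hn.symm 0) ^ 2 ∧
    3 / 2 * hH.eigenvalues₀ (Fin.cast hn.symm 0) ^ 2 ≤ ∑ i, ∑ j, M i j ^ 2 ∧
    ∑ i, ∑ j, M i j ^ 2 ≤ 6 * hH.eigenvalues₀ (Fin.cast hn.symm 2) ^ 2 ∧
    3 / 2 * hH.eigenvalues₀ (Fin.cast hn.symm 2) ^ 2 ≤ ∑ i, ∑ j, M i j ^ 2 ∧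
    6 * hH.eigenvalues₀ (Fin.cast hn.symm 1) ^ 2 ≤ ∑ i, ∑ j, M i j ^ 2 := by
  obtain ⟨h10, h21, hsum, -, hfro⟩ := eigenvalues_bookkeeping hn M hH htr
  rw [hfro]
  exact ⟨sum_sq_le_six_mul_top_sq h10 h21 hsum, three_halves_top_sq_le_sum_sq h21 hsum,
    sum_sq_le_six_mul_bot_sq h10 h21 hsum, three_halves_bot_sq_le_sum_sq h10 hsum,
    six_mul_middle_sq_le_sum_sq h10 h21 hsum⟩

end Matrix3b

end Chae2005

/-- **Exact one-snapshot form of the enstrophy balance in the middle eigenvalue** (Chae's Thm 2.1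
with `−λ₁λ₂λ₃ = ½λ₂(λ₁² + λ₂² + λ₃²) − λ₂³`, i.e. `−4det S = 2λ₂|S|² − 4λ₂³` pointwise): along a
classical solution of the unforced Navier–Stokes equations on `T^d × [a, b]` (`card d = 3`,
`a < b`, any `ν`; Euler `ν = 0`), at every `t ∈ [a, b]`,
`dℰ/dt = −ν‖Δu(t)‖₂² + ∫ (2λ₂(t,x)·∑ᵢⱼSᵢⱼ(t,x)² − 4λ₂(t,x)³) dx`
(one-sided derivative within `[a, b]`; `λ₂ = eigenvalues₀ 1` of the strain matrix). Both halves of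
Theorem 2.2 are read off from this identity. [cite: Chae2005, Thm 2.1 with (2.8a)–(2.9)] -/
theorem _root_.Literature.Analysis.FunctionSpaces.Torus.IsClassicalNSSolutionOn.hasDerivWithinAt_torusEnstrophy_middleEigenvalue
    (hd : Fintype.card d = 3) {a b ν : ℝ} {u : ℝ → UnitAddTorus d → EuclideanSpace ℝ d}
    {p : ℝ → UnitAddTorus d → ℝ} (h : Torus.IsClassicalNSSolutionOn (Icc a b) ν 0 u p)
    (hab : a < b) {t : ℝ} (ht : t ∈ Icc a b) :
    HasDerivWithinAt (fun s => torusEnstrophy (u s))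
      (-ν * (∫ x, ‖Torus.laplacian (u t) x‖ ^ 2) +
        ∫ x, (2 * (isHermitian_strainMatrix (u t) x).eigenvalues₀ (Fin.cast hd.symm 1) *
            (∑ i, ∑ j, ((Torus.partialDeriv j (u t) x i + Torus.partialDeriv i (u t) x j) / 2) ^ 2) -
          4 * (isHermitian_strainMatrix (u t) x).eigenvalues₀ (Fin.cast hd.symm 1) ^ 3))
      (Icc a b) t := by
  have hut : Torus.IsSmooth (u t) := h.smooth_velocity.isSmooth_slice ht
  have hdivt : Torus.IsDivFree (u t) := h.divFree t ht
  have hbal := h.hasDerivWithinAt_torusEnstrophy_det hd hab ht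
  refine hbal.congr_deriv ?_
  have hpt : ∀ x, -4 * Matrix.det (Matrix.of fun i j =>
      (Torus.partialDeriv j (u t) x i + Torus.partialDeriv i (u t) x j) / 2) =
      2 * (isHermitian_strainMatrix (u t) x).eigenvalues₀ (Fin.cast hd.symm 1) *
          (∑ i, ∑ j, ((Torus.partialDeriv j (u t) x i + Torus.partialDeriv i (u t) x j) / 2) ^ 2) -
        4 * (isHermitian_strainMatrix (u t) x).eigenvalues₀ (Fin.cast hd.symm 1) ^ 3 := by
    intro x
    have h1 := Chae2005.neg_det_eq_half_middle_mul_sum_sq_sub_cube hd _ (isHermitian_strainMatrix (u t) x)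
      (trace_strainMatrix_eq_zero hut hdivt x)
    simp only [Matrix.of_apply] at h1
    linarith
  have hdetI : Integrable (fun x => Matrix.det (Matrix.of fun i j =>
      (Torus.partialDeriv j (u t) x i + Torus.partialDeriv i (u t) x j) / 2)) volume := by
    have h3 : Torus.IsSmooth (fun x => ∑ i, ∑ j, ∑ k,
        ((Torus.partialDeriv j (u t) x i + Torus.partialDeriv i (u t) x j) / 2) *
        ((Torus.partialDeriv k (u t) x j + Torus.partialDeriv j (u t) x k) / 2) *
        ((Torus.partialDeriv i (u t) x k + Torus.partialDeriv k (u t) x i) / 2)) := by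
      have hD : ∀ m, Torus.IsSmooth (Torus.partialDeriv m (u t)) := fun m => hut.partialDeriv m
      have hDc : ∀ m j, Torus.IsSmooth (fun y => Torus.partialDeriv m (u t) y j) :=
        fun m j => (hD m).apply j
      have hSc : ∀ i j, Torus.IsSmooth (fun x => (Torus.partialDeriv j (u t) x i +
          Torus.partialDeriv i (u t) x j) / 2) := fun i j => ((hDc j i).add (hDc i j)).div_const 2
      have hh : ∀ i j k, Torus.IsSmooth (fun x =>
          ((Torus.partialDeriv j (u t) x i + Torus.partialDeriv i (u t) x j) / 2) *
          ((Torus.partialDeriv k (u t) x j + Torus.partialDeriv j (u t) x k) / 2) *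
          ((Torus.partialDeriv i (u t) x k + Torus.partialDeriv k (u t) x i) / 2)) :=
        fun i j k => ((hSc i j).mul (hSc j k)).mul (hSc k i)
      unfold Torus.IsSmooth at hh ⊢
      exact ContDiff.sum fun i _ => ContDiff.sum fun j _ => ContDiff.sum fun k _ => hh i j k
    exact (h3.integrable.const_mul (1 / 3 : ℝ)).congr
      (Filter.Eventually.of_forall fun x => (det_strain_eq_third_sum_strain_cube hd hut hdivt x).symm)
  have hI : (∫ x, (2 * (isHermitian_strainMatrix (u t) x).eigenvalues₀ (Fin.cast hd.symm 1) *
      (∑ i, ∑ j, ((Torus.partialDeriv j (u t) x i + Torus.partialDeriv i (u t) x j) / 2) ^ 2) -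
      4 * (isHermitian_strainMatrix (u t) x).eigenvalues₀ (Fin.cast hd.symm 1) ^ 3)) =
      ∫ x, -4 * Matrix.det (Matrix.of fun i j =>
        (Torus.partialDeriv j (u t) x i + Torus.partialDeriv i (u t) x j) / 2) :=
    integral_congr_ae (Filter.Eventually.of_forall fun x => (hpt x).symm)
  rw [hI, integral_const_mul]
  ring

end Literature.Analysis.FluidPDE
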